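import Mathlib
import Literature.Analysis.FluidPDE.OseenTensorRepresentation
import Literature.Analysis.FluidPDE.LerayVolterraComparison
import HarnessLib

/-!
# The Oseen-tensor Duhamel integral of a force, and its `O(√lag)` bound for scale-invariant
# (Type-I weight) forces

Analysis/FluidPDE file: ONE definition (`oseenForceDuhamel`, the force term of the Oseen integral
equation written with the physical-space kernel `𝒪_τ` of `e^{τΔ}P`, tree `oseenTensor`) and
theorems (no named facts).

For the Navier–Stokes system with a force `f`, the Oseen (mild) integral equation reads
`u(t) = e^{ν(t-s)Δ}u(s) - B^ν_s(u,u)(t) + ∫ₛᵗ e^{ν(t-τ)Δ} P f(τ) dτ` (Lemarié-Rieusset 2016,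
Thm. 6.1, (6.12): `u = W_{νt} ∗ u₀ + ∫₀ᵗ W_{ν(t-s)} ∗ Pf ds - B(u,u)`; the tree's `oseenDuhamel` is
`B^ν_s` and `forceDuhamel` is the force term for an ALREADY divergence-free force, where `P` may
be dropped). For a force that is not divergence free the Leray projection is carried by the
kernel: `e^{τΔ}P g (x) = ∫ 𝒪_τ(x - y) g(y) dy` with the Oseen tensor
`𝒪_τ(z) a = (G_τ(z) - A₁(τ,z)) a + A(τ,z)⟪z,a⟫z` (Lemarié-Rieusset 2016, §6.2; Oseen 1911; tree
`oseenTensor`, `heatExtension_classicalLerayProj_eq_integral_oseenTensor`). This file supplies: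

* `oseenForceDuhamel ν s g t x = ∫_{τ∈(s,t)} ∫ 𝒪_{ν(t-τ)}(x - y) g(τ, y) dy dτ` (definition);
* `exists_norm_oseenTensor_le` — the parabolic majorant `‖𝒪_τ(z) a‖ ≤ C (τ + ‖z‖²)^{-d/2} ‖a‖`
  (from the tree's bounds on `G_τ`, `A`, `A₁`);
* `exists_integral_oseenTensor_weight_le` — **the slice estimate** on `ℝ³`: if
  `‖g(y)‖ ≤ ε (‖y‖ + a)⁻³` (`a > 0`) then `∫ ‖𝒪_τ(x - y) g(y)‖ dy ≤ C ε τ^{-1/2} a⁻²` for all `x`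
  (Hölder `L^{3/2} × L³`: `‖(τ + ‖·‖²)^{-3/2}‖_{3/2} = c τ^{-1/2}` and `‖(‖·‖ + a)⁻³‖₃ = c' a⁻²`
  by scaling);
* `exists_norm_oseenForceDuhamel_le_of_weight` — **the `O(√lag)` bound for Type-I-weighted
  forces on the past**: if `‖g(τ, y)‖ ≤ ε (‖y‖ + √(-τ))⁻³` for `τ < 0` then for all `s < t < 0`
  and all `x`, `‖oseenForceDuhamel ν s g t x‖ ≤ κ ε √(t - s) / (√ν (-t))` — the scale-invariant
  weight `(‖y‖ + √-τ)⁻³` is that of `(u·∇)u` for a Type-I field `‖u‖ ≤ C/(‖y‖ + √-τ)`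
  (Koch–Nadirashvili–Seregin–Šverák 2009, (1.6)), and the conclusion is the `γ(t)√(t-s)`
  hypothesis of the tree's forced compactness engine `exists_oseenMild_limit_of_forced`
  (`AncientMildCompactnessForced.lean`) with `γ(t) = κ ε/(√ν (-t))`, monotone on `(-∞, 0)`.

Cell `ns-blowup` label: LABEL Literature port (KERNEL estimate + one definition); bears_on
LADDER-NS N1 route `AngularGalerkinLadder`, crux K3a `LocalCompactness`
(stmt-NavierStokesRegularity-19856), skeleton stub A («window profiles are forced-Oseen-mild with
an `ε Φ(t) √(t-s)` remainder»: this file is the remainder ESTIMATE; the representation itself is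
the business of `ClassicalCurlPairDuality.lean` + a sequel). WHAT THIS IS NOT: not NS — a
definition and a kernel estimate; nothing is asserted about any solution.

## Mathlib / tree search

Tree: `oseenTensor`, `norm_oseenTensor_le`, `exists_oseenWeightA_le`, `exists_oseenWeightA1_le`,
`exists_heatKernel_le_rpow` (`OseenTensorKernel`, `KochTataruKernel`), `oseenDuhamel`
(`NSBoundedMildOseen`), `forceDuhamel` (`ForcedOseenRepresentation`: heat kernel, divergence-free
forces only). `lean search 'oseenForce|forceOseen|lerayHeatForcing'`: only the complexified
BGK objects `lerayHeatPotC`/`lerayHeatForcingC` (`LerayHeatForcingComplex`, test-field forces).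
Mathlib: `integral_mul_le_Lp_mul_Lq_of_nonneg` (Hölder), `Measure.integral_comp_smul`
(scaling), `integrable_one_add_norm`, `integrable_rpow_neg_one_add_norm_sq` (Japanese bracket).

## References

* P. G. Lemarié-Rieusset, *The Navier–Stokes Problem in the 21st Century*, CRC Press 2016, §6.2
  (the Oseen tensor) and Thm. 6.1 (6.12) (the integral equation with force). [LemarieRieusset2016]
* G. Koch, N. Nadirashvili, G. Seregin, V. Šverák, Acta Math. 203 (2009) = arXiv:0709.3599, §1
  (1.6) (Type-I weight), §4 (4.3)–(4.5) (kernel bounds of the Duhamel term).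
  [KochNadirashviliSereginSverak2009]
* H. Koch, D. Tataru, Adv. Math. 157 (2001), §2 (6)–(8) (kernel of `e^{tΔ}P`).
  [KochTataruAdvMath2001]
-/

noncomputable section

open MeasureTheory Set Function Filter Metric Real
open _root_.Topology
open scoped InnerProductSpace RealInnerProductSpace

namespace Literature.Analysis.FluidPDE

/-! ### The definition -/

section Definition

variable {E : Type*} [NormedAddCommGroup E] [InnerProductSpace ℝ E] [FiniteDimensional ℝ E]
  [MeasurableSpace E] [BorelSpace E]

/-- **The Oseen-tensor Duhamel integral of a force** with viscosity `ν` from the base time `s`: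
`oseenForceDuhamel ν s g t x = ∫_{τ ∈ (s,t)} ∫ 𝒪_{ν(t-τ)}(x - y) g(τ, y) dy dτ
 = (∫ₛᵗ e^{ν(t-τ)Δ} P g(τ) dτ)(x)`, `𝒪` the Oseen tensor (kernel of `e^{τΔ}P`,
Lemarié-Rieusset 2016, §6.2) — the force term of the Oseen integral equation
`u = W_{νt} ∗ u₀ + ∫₀ᵗ W_{ν(t-s)} ∗ Pf ds - B(u,u)` (Lemarié-Rieusset 2016, Thm. 6.1, (6.12))
for a force that need not be divergence free (for divergence-free forces it reduces to the
tree's heat-kernel `forceDuhamel`). Iterated Bochner integrals, junk `0` where divergent; `0`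
for `t ≤ s`. [cite: LemarieRieusset2016, Thm. 6.1 (6.12) with §6.2] -/
def oseenForceDuhamel (ν s : ℝ) (g : ℝ → E → E) (t : ℝ) (x : E) : E :=
  ∫ τ in Ioo s t, ∫ y, oseenTensor (ν * (t - τ)) (x - y) (g τ y)

/-- Unfolding `oseenForceDuhamel`. [cite: LemarieRieusset2016, Thm. 6.1 (6.12)] -/
theorem oseenForceDuhamel_apply (ν s : ℝ) (g : ℝ → E → E) (t : ℝ) (x : E) :
    oseenForceDuhamel ν s g t x =
      ∫ τ in Ioo s t, ∫ y, oseenTensor (ν * (t - τ)) (x - y) (g τ y) := rfl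

/-- No elapsed time, no force term: `oseenForceDuhamel ν s g t = 0` for `t ≤ s`.
[cite: LemarieRieusset2016, Thm. 6.1 (6.12)] -/
theorem oseenForceDuhamel_of_le {ν s t : ℝ} (hts : t ≤ s) (g : ℝ → E → E) :
    oseenForceDuhamel ν s g t = 0 := by
  funext x
  simp [oseenForceDuhamel, Ioo_eq_empty_of_le hts]

end Definition

/-! ### The parabolic majorant of the Oseen tensor -/

section Majorant

variable {E : Type*} [NormedAddCommGroup E] [InnerProductSpace ℝ E] [FiniteDimensional ℝ E]
  [MeasurableSpace E] [BorelSpace E]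

omit [FiniteDimensional ℝ E] [MeasurableSpace E] [BorelSpace E] in
/-- **Parabolic majorant of the Oseen tensor**: in positive dimension `d` there is `C > 0` with
`‖𝒪_τ(z) a‖ ≤ C (τ + ‖z‖²)^{-d/2} ‖a‖` for all `τ > 0`, `z`, `a` (the Gaussian `G_τ`, the weight
`A₁` and `A ‖z‖²` are each so bounded: tree `exists_heatKernel_le_rpow`,
`exists_oseenWeightA1_le`, `exists_oseenWeightA_le`). Lemarié-Rieusset 2016, §6.2
(`|𝒪(t, x)| ≤ C (√t + |x|)^{-d}`). [cite: LemarieRieusset2016, §6.2] -/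
theorem exists_norm_oseenTensor_le (hE : 0 < Module.finrank ℝ E) :
    ∃ C : ℝ, 0 < C ∧ ∀ {τ : ℝ}, 0 < τ → ∀ z a : E,
      ‖oseenTensor τ z a‖ ≤ C * (τ + ‖z‖ ^ 2) ^ (-((Module.finrank ℝ E : ℝ) / 2)) * ‖a‖ := by
  set d : ℝ := (Module.finrank ℝ E : ℝ) with hd
  obtain ⟨C₀, hC₀, hG⟩ := exists_heatKernel_le_rpow (E := E) (d / 2)
  obtain ⟨C₁, hC₁, hA1⟩ := exists_oseenWeightA1_le (E := E) hE
  obtain ⟨C₂, hC₂, hA⟩ := exists_oseenWeightA_le (E := E)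
  refine ⟨C₀ + C₁ + C₂, by positivity, fun {τ} hτ z a => ?_⟩
  have hq : 0 < τ + ‖z‖ ^ 2 := by positivity
  obtain ⟨-, -, hA1le⟩ := hA1 hτ z
  obtain ⟨-, hA0, hAle⟩ := hA hτ z
  have hGle : UnboundedOperators.heatKernel τ z ≤ C₀ * (τ + ‖z‖ ^ 2) ^ (-(d / 2)) := by
    have h := hG hτ z
    have e : d / 2 - (Module.finrank ℝ E : ℝ) / 2 = 0 := by rw [hd]; ring
    rw [e, Real.rpow_zero, mul_one] at h
    exact h
  have hAz : oseenWeightA τ z * ‖z‖ ^ 2 ≤ C₂ * (τ + ‖z‖ ^ 2) ^ (-(d / 2)) := by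
    have h1 : oseenWeightA τ z * ‖z‖ ^ 2 ≤
        C₂ * (τ + ‖z‖ ^ 2) ^ (-((Module.finrank ℝ E : ℝ) / 2 + 1)) * (τ + ‖z‖ ^ 2) :=
      mul_le_mul hAle (by nlinarith [hτ.le]) (by positivity)
        (by positivity)
    have e : C₂ * (τ + ‖z‖ ^ 2) ^ (-((Module.finrank ℝ E : ℝ) / 2 + 1)) * (τ + ‖z‖ ^ 2) =
        C₂ * (τ + ‖z‖ ^ 2) ^ (-(d / 2)) := by
      rw [hd, show -((Module.finrank ℝ E : ℝ) / 2 + 1) = -((Module.finrank ℝ E : ℝ) / 2) + (-1) by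
        ring, Real.rpow_add hq, Real.rpow_neg_one]
      field_simp
    rw [e] at h1
    exact h1
  calc ‖oseenTensor τ z a‖
      ≤ (UnboundedOperators.heatKernel τ z + oseenWeightA1 τ z + oseenWeightA τ z * ‖z‖ ^ 2) * ‖a‖ :=
        norm_oseenTensor_le hE hτ z a
    _ ≤ (C₀ * (τ + ‖z‖ ^ 2) ^ (-(d / 2)) + C₁ * (τ + ‖z‖ ^ 2) ^ (-(d / 2)) +
          C₂ * (τ + ‖z‖ ^ 2) ^ (-(d / 2))) * ‖a‖ := by
        refine mul_le_mul_of_nonneg_right ?_ (norm_nonneg _)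
        exact add_le_add (add_le_add hGle hA1le) hAz
    _ = (C₀ + C₁ + C₂) * (τ + ‖z‖ ^ 2) ^ (-(d / 2)) * ‖a‖ := by ring

end Majorant

/-! ### Scaling of the two model integrals on `(EuclideanSpace ℝ (Fin 3))` -/

section Scaling

/-- `w ↦ (1 + ‖w‖²)^{-9/4}` is integrable on `(EuclideanSpace ℝ (Fin 3))` (`9/2 > 3`; Mathlib
`integrable_rpow_neg_one_add_norm_sq`). [folklore] -/
private theorem integrable_one_add_norm_sq_rpow :
    Integrable (fun w : (EuclideanSpace ℝ (Fin 3)) => ((1 : ℝ) + ‖w‖ ^ 2) ^ (-(9 : ℝ) / 4)) := by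
  have h := integrable_rpow_neg_one_add_norm_sq (E := (EuclideanSpace ℝ (Fin 3))) (μ := volume) (r := 9 / 2)
    (by rw [finrank_euclideanSpace_fin]; norm_num)
  refine h.congr (Eventually.of_forall fun w => ?_)
  norm_num

/-- `w ↦ (‖w‖ + 1)⁻⁹` is integrable on `(EuclideanSpace ℝ (Fin 3))` (`9 > 3`; Mathlib `integrable_one_add_norm`).
[folklore] -/
private theorem integrable_norm_add_one_inv_pow :
    Integrable (fun w : (EuclideanSpace ℝ (Fin 3)) => ((‖w‖ + 1) ^ 9)⁻¹) := by
  have h := integrable_one_add_norm (E := (EuclideanSpace ℝ (Fin 3))) (μ := volume) (r := 9)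
    (by rw [finrank_euclideanSpace_fin]; norm_num)
  refine h.congr (Eventually.of_forall fun w => ?_)
  show (1 + ‖w‖) ^ (-(9 : ℝ)) = ((‖w‖ + 1) ^ 9)⁻¹
  rw [add_comm (1 : ℝ) ‖w‖, Real.rpow_neg (by positivity)]
  norm_num

/-- **Scaling of the kernel model integral**: `∫ (τ + ‖z‖²)^{-9/4} dz = τ^{-3/4} ∫ (1 + ‖w‖²)^{-9/4} dw`
on `(EuclideanSpace ℝ (Fin 3))` (`z = √τ w`). [folklore] -/
private theorem integral_add_norm_sq_rpow {τ : ℝ} (hτ : 0 < τ) :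
    ∫ z : (EuclideanSpace ℝ (Fin 3)), (τ + ‖z‖ ^ 2) ^ (-(9 : ℝ) / 4) =
      τ ^ (-(3 : ℝ) / 4) * ∫ w : (EuclideanSpace ℝ (Fin 3)), ((1 : ℝ) + ‖w‖ ^ 2) ^ (-(9 : ℝ) / 4) := by
  set R : ℝ := Real.sqrt τ with hR
  have hR0 : 0 < R := Real.sqrt_pos.2 hτ
  have hRsq : R ^ 2 = τ := Real.sq_sqrt hτ.le
  -- `∫ f(R • w) dw = (R³)⁻¹ ∫ f`
  have hsc := Measure.integral_comp_smul_of_nonneg (μ := (volume : Measure (EuclideanSpace ℝ (Fin 3))))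
    (fun z : (EuclideanSpace ℝ (Fin 3)) => (τ + ‖z‖ ^ 2) ^ (-(9 : ℝ) / 4)) R (hR := hR0.le)
  rw [finrank_euclideanSpace_fin] at hsc
  -- the integrand at `R • w`
  have hpt : ∀ w : (EuclideanSpace ℝ (Fin 3)), (τ + ‖R • w‖ ^ 2) ^ (-(9 : ℝ) / 4) =
      τ ^ (-(9 : ℝ) / 4) * ((1 : ℝ) + ‖w‖ ^ 2) ^ (-(9 : ℝ) / 4) := by
    intro w
    rw [norm_smul, Real.norm_of_nonneg hR0.le, mul_pow, hRsq,
      show τ + τ * ‖w‖ ^ 2 = τ * (1 + ‖w‖ ^ 2) by ring,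
      Real.mul_rpow hτ.le (by positivity)]
  simp_rw [hpt, integral_const_mul] at hsc
  -- solve for `∫ f`
  have hR3 : (R ^ 3)⁻¹ ≠ 0 := inv_ne_zero (pow_ne_zero _ hR0.ne')
  have key : ∫ z : (EuclideanSpace ℝ (Fin 3)), (τ + ‖z‖ ^ 2) ^ (-(9 : ℝ) / 4) =
      R ^ 3 * (τ ^ (-(9 : ℝ) / 4) * ∫ w : (EuclideanSpace ℝ (Fin 3)), ((1 : ℝ) + ‖w‖ ^ 2) ^ (-(9 : ℝ) / 4)) := by
    have h2 := congrArg (fun r => R ^ 3 * r) hsc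
    simp only [smul_eq_mul] at h2
    rw [mul_inv_cancel_left₀ (pow_ne_zero _ hR0.ne')] at h2
    exact h2.symm
  rw [key, ← mul_assoc]
  congr 1
  -- `R³ τ^{-9/4} = τ^{-3/4}`
  have hR3' : R ^ 3 = τ ^ ((3 : ℝ) / 2) := by
    rw [hR, Real.sqrt_eq_rpow, ← Real.rpow_natCast, ← Real.rpow_mul hτ.le]
    norm_num
  rw [hR3', ← Real.rpow_add hτ]
  norm_num

/-- **Scaling of the force model integral**: `∫ (‖y‖ + a)⁻⁹ dy = a⁻⁶ ∫ (‖w‖ + 1)⁻⁹ dw` on `(EuclideanSpace ℝ (Fin 3))`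
(`y = a w`). [folklore] -/
private theorem integral_norm_add_inv_pow {a : ℝ} (ha : 0 < a) :
    ∫ y : (EuclideanSpace ℝ (Fin 3)), ((‖y‖ + a) ^ 9)⁻¹ = (a ^ 6)⁻¹ * ∫ w : (EuclideanSpace ℝ (Fin 3)), ((‖w‖ + 1) ^ 9)⁻¹ := by
  have hsc := Measure.integral_comp_smul_of_nonneg (μ := (volume : Measure (EuclideanSpace ℝ (Fin 3))))
    (fun y : (EuclideanSpace ℝ (Fin 3)) => ((‖y‖ + a) ^ 9)⁻¹) a (hR := ha.le)
  rw [finrank_euclideanSpace_fin] at hsc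
  have hpt : ∀ w : (EuclideanSpace ℝ (Fin 3)), ((‖a • w‖ + a) ^ 9)⁻¹ = (a ^ 9)⁻¹ * ((‖w‖ + 1) ^ 9)⁻¹ := by
    intro w
    rw [norm_smul, Real.norm_of_nonneg ha.le, show a * ‖w‖ + a = a * (‖w‖ + 1) by ring, mul_pow,
      mul_inv]
  simp_rw [hpt, integral_const_mul] at hsc
  have key : ∫ y : (EuclideanSpace ℝ (Fin 3)), ((‖y‖ + a) ^ 9)⁻¹ =
      a ^ 3 * ((a ^ 9)⁻¹ * ∫ w : (EuclideanSpace ℝ (Fin 3)), ((‖w‖ + 1) ^ 9)⁻¹) := by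
    have h2 := congrArg (fun r => a ^ 3 * r) hsc
    simp only [smul_eq_mul] at h2
    rw [mul_inv_cancel_left₀ (pow_ne_zero _ ha.ne')] at h2
    exact h2.symm
  rw [key, ← mul_assoc]
  congr 1
  field_simp

end Scaling

/-! ### The slice estimate: `L^{3/2} × L³` Hölder -/

section SliceBound

/-- `(3/2, 3)` are Hölder conjugate. [folklore] -/
private theorem oseenForce_holderConjugate_threeHalves_three : (3 / 2 : ℝ).HolderConjugate 3 := by
  rw [Real.holderConjugate_iff]
  norm_num

/-- The Hölder triple `(3/2, 3, 1)` in `ℝ≥0∞`. [folklore] -/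
private theorem oseenForce_holderTriple_threeHalves_three :
    ENNReal.HolderTriple (ENNReal.ofReal (3 / 2 : ℝ)) (ENNReal.ofReal (3 : ℝ)) 1 := by
  refine ⟨?_⟩
  have h1 : ENNReal.ofReal (3 / 2 : ℝ) = 3 / 2 := by
    rw [ENNReal.ofReal_div_of_pos (by norm_num)]
    simp
  have h2 : ENNReal.ofReal (3 : ℝ) = 3 := by simp
  rw [h1, h2, inv_one, ENNReal.inv_div (Or.inr (by norm_num)) (Or.inr (by norm_num)),
    show (3 : ENNReal)⁻¹ = 1 / 3 from (one_div 3).symm, ENNReal.div_add_div_same,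
    show (2 : ENNReal) + 1 = 3 by norm_num]
  exact ENNReal.div_self (by norm_num) (by norm_num)

/-- **The kernel majorant translate is in `L^{3/2}`**, with
`∫ ((τ + ‖x - y‖²)^{-3/2})^{3/2} dy = τ^{-3/4} J₁`. [folklore] -/
private theorem memLp_kernelMajorant {τ : ℝ} (hτ : 0 < τ) (x : (EuclideanSpace ℝ (Fin 3))) :
    MemLp (fun y : (EuclideanSpace ℝ (Fin 3)) => (τ + ‖x - y‖ ^ 2) ^ (-(3 : ℝ) / 2)) (ENNReal.ofReal (3 / 2 : ℝ)) volume ∧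
      ∫ y : (EuclideanSpace ℝ (Fin 3)), ((τ + ‖x - y‖ ^ 2) ^ (-(3 : ℝ) / 2)) ^ (3 / 2 : ℝ) =
        τ ^ (-(3 : ℝ) / 4) * ∫ w : (EuclideanSpace ℝ (Fin 3)), ((1 : ℝ) + ‖w‖ ^ 2) ^ (-(9 : ℝ) / 4) := by
  have hpow : ∀ y : (EuclideanSpace ℝ (Fin 3)), ((τ + ‖x - y‖ ^ 2) ^ (-(3 : ℝ) / 2)) ^ (3 / 2 : ℝ) =
      (τ + ‖x - y‖ ^ 2) ^ (-(9 : ℝ) / 4) := by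
    intro y
    rw [← Real.rpow_mul (by positivity)]
    norm_num
  -- integrability of the `3/2`-power: a translate of the scaled Japanese bracket
  have hint : Integrable (fun y : (EuclideanSpace ℝ (Fin 3)) => (τ + ‖x - y‖ ^ 2) ^ (-(9 : ℝ) / 4)) := by
    have h0 : Integrable (fun z : (EuclideanSpace ℝ (Fin 3)) => (τ + ‖z‖ ^ 2) ^ (-(9 : ℝ) / 4)) := by
      set R : ℝ := Real.sqrt τ with hR
      have hR0 : 0 < R := Real.sqrt_pos.2 hτ
      have hRsq : R ^ 2 = τ := Real.sq_sqrt hτ.le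
      -- `z ↦ f(R⁻¹ z)` with `f` the Japanese bracket
      have h1 := (integrable_one_add_norm_sq_rpow.comp_smul (inv_ne_zero hR0.ne')).const_mul
        (τ ^ (-(9 : ℝ) / 4))
      refine h1.congr (Eventually.of_forall fun z => ?_)
      show τ ^ (-(9 : ℝ) / 4) * ((1 : ℝ) + ‖R⁻¹ • z‖ ^ 2) ^ (-(9 : ℝ) / 4) = (τ + ‖z‖ ^ 2) ^ (-(9 : ℝ) / 4)
      rw [norm_smul, norm_inv, Real.norm_of_nonneg hR0.le, mul_pow, inv_pow, hRsq,
        show (1 : ℝ) + τ⁻¹ * ‖z‖ ^ 2 = τ⁻¹ * (τ + ‖z‖ ^ 2) by field_simp,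
        Real.mul_rpow (by positivity) (by positivity), Real.inv_rpow hτ.le, ← mul_assoc,
        ← Real.rpow_neg_one, ← Real.rpow_mul hτ.le, ← Real.rpow_add hτ]
      norm_num
    have h2 := h0.comp_sub_left x
    exact h2
  have hmeas : AEStronglyMeasurable (fun y : (EuclideanSpace ℝ (Fin 3)) => (τ + ‖x - y‖ ^ 2) ^ (-(3 : ℝ) / 2)) volume := by
    refine (Continuous.rpow_const (by fun_prop) fun y => Or.inl ?_).aestronglyMeasurable
    positivity
  refine ⟨?_, ?_⟩
  · rw [← integrable_norm_rpow_iff hmeas (by simp) (by simp),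
      ENNReal.toReal_ofReal (by norm_num)]
    refine hint.congr (Eventually.of_forall fun y => ?_)
    show (τ + ‖x - y‖ ^ 2) ^ (-(9 : ℝ) / 4) = ‖(τ + ‖x - y‖ ^ 2) ^ (-(3 : ℝ) / 2)‖ ^ (3 / 2 : ℝ)
    rw [Real.norm_of_nonneg (by positivity), hpow]
  · simp_rw [hpow]
    rw [integral_sub_left_eq_self (fun z : (EuclideanSpace ℝ (Fin 3)) => (τ + ‖z‖ ^ 2) ^ (-(9 : ℝ) / 4)) volume x]
    exact integral_add_norm_sq_rpow hτ

/-- **The force majorant is in `L³`**, with `∫ (ε (‖y‖ + a)⁻³)³ dy = ε³ a⁻⁶ J₂`. [folklore] -/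
private theorem memLp_forceMajorant {a ε : ℝ} (ha : 0 < a) (hε : 0 ≤ ε) :
    MemLp (fun y : (EuclideanSpace ℝ (Fin 3)) => ε / (‖y‖ + a) ^ 3) (ENNReal.ofReal (3 : ℝ)) volume ∧
      ∫ y : (EuclideanSpace ℝ (Fin 3)), (ε / (‖y‖ + a) ^ 3) ^ (3 : ℝ) =
        ε ^ 3 * ((a ^ 6)⁻¹ * ∫ w : (EuclideanSpace ℝ (Fin 3)), ((‖w‖ + 1) ^ 9)⁻¹) := by
  have hpow : ∀ y : (EuclideanSpace ℝ (Fin 3)), (ε / (‖y‖ + a) ^ 3) ^ (3 : ℝ) = ε ^ 3 * ((‖y‖ + a) ^ 9)⁻¹ := by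
    intro y
    rw [show (3 : ℝ) = ((3 : ℕ) : ℝ) by norm_num, Real.rpow_natCast, div_pow, ← pow_mul]
    norm_num
    rw [div_eq_mul_inv]
  have hint : Integrable (fun y : (EuclideanSpace ℝ (Fin 3)) => ε ^ 3 * ((‖y‖ + a) ^ 9)⁻¹) := by
    have h1 := (integrable_norm_add_one_inv_pow.comp_smul (inv_ne_zero ha.ne')).const_mul
      (ε ^ 3 * (a ^ 9)⁻¹)
    refine h1.congr (Eventually.of_forall fun y => ?_)
    show ε ^ 3 * (a ^ 9)⁻¹ * ((‖a⁻¹ • y‖ + 1) ^ 9)⁻¹ = ε ^ 3 * ((‖y‖ + a) ^ 9)⁻¹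
    rw [norm_smul, norm_inv, Real.norm_of_nonneg ha.le,
      show a⁻¹ * ‖y‖ + 1 = a⁻¹ * (‖y‖ + a) by field_simp, mul_pow, inv_pow, mul_inv, inv_inv]
    field_simp
  have hmeas : AEStronglyMeasurable (fun y : (EuclideanSpace ℝ (Fin 3)) => ε / (‖y‖ + a) ^ 3) volume := by
    refine (continuous_const.div (by fun_prop) fun y => ?_).aestronglyMeasurable
    positivity
  refine ⟨?_, ?_⟩
  · rw [← integrable_norm_rpow_iff hmeas (by simp) (by simp), ENNReal.toReal_ofReal (by norm_num)]
    refine hint.congr (Eventually.of_forall fun y => ?_)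
    show ε ^ 3 * ((‖y‖ + a) ^ 9)⁻¹ = ‖ε / (‖y‖ + a) ^ 3‖ ^ (3 : ℝ)
    rw [Real.norm_of_nonneg (by positivity), hpow]
  · simp_rw [hpow]
    rw [integral_const_mul, integral_norm_add_inv_pow ha]

/-- The domination data behind the slice estimate: an integrable majorant of
`y ↦ ‖𝒪_τ(x − y) g(y)‖` with integral `≤ C ε τ^{-1/2} a⁻²`. [cite: KochNadirashviliSereginSverak2009, §4 (4.3)–(4.5)] -/
private theorem exists_oseenTensor_weight_dominated :
    ∃ C : ℝ, 0 < C ∧ ∀ {τ : ℝ}, 0 < τ → ∀ {a : ℝ}, 0 < a → ∀ {ε : ℝ}, 0 ≤ ε →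
      ∀ (g : (EuclideanSpace ℝ (Fin 3)) → (EuclideanSpace ℝ (Fin 3))), (∀ y, ‖g y‖ ≤ ε / (‖y‖ + a) ^ 3) → ∀ x : (EuclideanSpace ℝ (Fin 3)),
        ∃ h : (EuclideanSpace ℝ (Fin 3)) → ℝ, Integrable h ∧
          (∀ y, ‖oseenTensor τ (x - y) (g y)‖ ≤ h y) ∧
          ∫ y, h y ≤ C * ε * τ ^ (-(1 : ℝ) / 2) * (a ^ 2)⁻¹ := by
  have hE : 0 < Module.finrank ℝ (EuclideanSpace ℝ (Fin 3)) := by rw [finrank_euclideanSpace_fin]; norm_num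
  obtain ⟨C₀, hC₀, hO⟩ := exists_norm_oseenTensor_le (E := (EuclideanSpace ℝ (Fin 3))) hE
  set J₁ : ℝ := ∫ w : (EuclideanSpace ℝ (Fin 3)), ((1 : ℝ) + ‖w‖ ^ 2) ^ (-(9 : ℝ) / 4) with hJ₁
  set J₂ : ℝ := ∫ w : (EuclideanSpace ℝ (Fin 3)), ((‖w‖ + 1) ^ 9)⁻¹ with hJ₂
  have hJ₁0 : 0 ≤ J₁ := integral_nonneg fun w => by positivity
  have hJ₂0 : 0 ≤ J₂ := integral_nonneg fun w => by positivity
  refine ⟨C₀ * J₁ ^ (2 / 3 : ℝ) * J₂ ^ (1 / 3 : ℝ) + 1, by positivity,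
    fun {τ} hτ {a} ha {ε} hε g hg x => ?_⟩
  have hd3 : (Module.finrank ℝ (EuclideanSpace ℝ (Fin 3)) : ℝ) = 3 := by rw [finrank_euclideanSpace_fin]; norm_num
  -- the two majorants
  set k : (EuclideanSpace ℝ (Fin 3)) → ℝ := fun y => (τ + ‖x - y‖ ^ 2) ^ (-(3 : ℝ) / 2) with hk
  set m : (EuclideanSpace ℝ (Fin 3)) → ℝ := fun y => ε / (‖y‖ + a) ^ 3 with hm
  obtain ⟨hkp, hkint⟩ := memLp_kernelMajorant hτ x
  obtain ⟨hmp, hmint⟩ := memLp_forceMajorant ha hε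
  have hk0 : ∀ y, 0 ≤ k y := fun y => by positivity
  have hm0 : ∀ y, 0 ≤ m y := fun y => by positivity
  -- pointwise domination of the integrand by `C₀ k m`
  have hdom : ∀ y, ‖oseenTensor τ (x - y) (g y)‖ ≤ C₀ * (k y * m y) := by
    intro y
    have h1 := hO hτ (x - y) (g y)
    rw [hd3] at h1
    calc ‖oseenTensor τ (x - y) (g y)‖ ≤ C₀ * (τ + ‖x - y‖ ^ 2) ^ (-((3 : ℝ) / 2)) * ‖g y‖ := h1
      _ ≤ C₀ * (τ + ‖x - y‖ ^ 2) ^ (-((3 : ℝ) / 2)) * (ε / (‖y‖ + a) ^ 3) :=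
          mul_le_mul_of_nonneg_left (hg y) (by positivity)
      _ = C₀ * (k y * m y) := by
          simp only [hk, hm, neg_div]
          ring
  -- Hölder
  haveI := oseenForce_holderTriple_threeHalves_three
  have hkm : Integrable (fun y => k y * m y) := hkp.integrable_mul hmp
  have hH := integral_mul_le_Lp_mul_Lq_of_nonneg oseenForce_holderConjugate_threeHalves_three
    (Eventually.of_forall hk0) (Eventually.of_forall hm0) hkp hmp
  rw [hkint, hmint] at hH
  -- evaluate the two factors
  have hf1 : (τ ^ (-(3 : ℝ) / 4) * J₁) ^ (1 / (3 / 2 : ℝ)) = τ ^ (-(1 : ℝ) / 2) * J₁ ^ (2 / 3 : ℝ) := by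
    rw [show (1 / (3 / 2 : ℝ)) = 2 / 3 by norm_num,
      Real.mul_rpow (Real.rpow_nonneg hτ.le _) hJ₁0, ← Real.rpow_mul hτ.le]
    norm_num
  have hf2 : (ε ^ 3 * ((a ^ 6)⁻¹ * J₂)) ^ (1 / (3 : ℝ)) = ε * (a ^ 2)⁻¹ * J₂ ^ (1 / 3 : ℝ) := by
    rw [Real.mul_rpow (by positivity) (by positivity), Real.mul_rpow (by positivity) hJ₂0,
      show (ε ^ 3) = ε ^ (3 : ℝ) by norm_num, ← Real.rpow_mul hε,
      show ((a ^ 6)⁻¹ : ℝ) = (a ^ 2) ^ (-(3 : ℝ)) by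
        rw [Real.rpow_neg (by positivity), show (3 : ℝ) = ((3 : ℕ) : ℝ) by norm_num,
          Real.rpow_natCast, ← pow_mul],
      ← Real.rpow_mul (by positivity)]
    norm_num
    rw [Real.rpow_neg (by positivity), Real.rpow_one]
    ring
  rw [hf1, hf2] at hH
  -- conclude
  have hτ0 : 0 ≤ τ ^ (-(1 : ℝ) / 2) := Real.rpow_nonneg hτ.le _
  have hB : ∫ y, C₀ * (k y * m y) ≤
      (C₀ * J₁ ^ (2 / 3 : ℝ) * J₂ ^ (1 / 3 : ℝ) + 1) * ε * τ ^ (-(1 : ℝ) / 2) * (a ^ 2)⁻¹ := by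
    calc ∫ y, C₀ * (k y * m y) = C₀ * ∫ y, k y * m y := integral_const_mul _ _
      _ ≤ C₀ * (τ ^ (-(1 : ℝ) / 2) * J₁ ^ (2 / 3 : ℝ) * (ε * (a ^ 2)⁻¹ * J₂ ^ (1 / 3 : ℝ))) :=
          mul_le_mul_of_nonneg_left hH hC₀.le
      _ = (C₀ * J₁ ^ (2 / 3 : ℝ) * J₂ ^ (1 / 3 : ℝ)) * ε * τ ^ (-(1 : ℝ) / 2) * (a ^ 2)⁻¹ := by ring
      _ ≤ (C₀ * J₁ ^ (2 / 3 : ℝ) * J₂ ^ (1 / 3 : ℝ) + 1) * ε * τ ^ (-(1 : ℝ) / 2) * (a ^ 2)⁻¹ := by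
          gcongr
          linarith
  exact ⟨fun y => C₀ * (k y * m y), hkm.const_mul C₀, hdom, hB⟩

/-- **The slice estimate.** There is `C > 0` such that for all `τ > 0`, `a > 0`, `ε ≥ 0`, every
`g : (EuclideanSpace ℝ (Fin 3)) → (EuclideanSpace ℝ (Fin 3))` with `‖g(y)‖ ≤ ε (‖y‖ + a)⁻³` and every `x`: the majorant
`y ↦ C₀ (τ + ‖x-y‖²)^{-3/2} · ε(‖y‖ + a)⁻³` is integrable and
`‖∫ 𝒪_τ(x - y) g(y) dy‖ ≤ C ε τ^{-1/2} a⁻²` (Hölder `L^{3/2} × L³` with the two scalings). This is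
the kernel estimate behind KNSS 2009 (4.5) for the force term with the Type-I weight.
[cite: KochNadirashviliSereginSverak2009, §4 (4.3)–(4.5)] -/
theorem exists_integral_oseenTensor_weight_le :
    ∃ C : ℝ, 0 < C ∧ ∀ {τ : ℝ}, 0 < τ → ∀ {a : ℝ}, 0 < a → ∀ {ε : ℝ}, 0 ≤ ε →
      ∀ (g : (EuclideanSpace ℝ (Fin 3)) → (EuclideanSpace ℝ (Fin 3))), (∀ y, ‖g y‖ ≤ ε / (‖y‖ + a) ^ 3) → ∀ x : (EuclideanSpace ℝ (Fin 3)),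
        (∫ y, ‖oseenTensor τ (x - y) (g y)‖) ≤ C * ε * τ ^ (-(1 : ℝ) / 2) * (a ^ 2)⁻¹ ∧
        ‖∫ y, oseenTensor τ (x - y) (g y)‖ ≤ C * ε * τ ^ (-(1 : ℝ) / 2) * (a ^ 2)⁻¹ := by
  obtain ⟨C, hC, h⟩ := exists_oseenTensor_weight_dominated
  refine ⟨C, hC, fun {τ} hτ {a} ha {ε} hε g hg x => ?_⟩
  obtain ⟨h, hint, hdom, hB⟩ := h hτ ha hε g hg x
  exact ⟨(integral_mono_of_nonneg (Eventually.of_forall fun y => norm_nonneg _) hint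
      (Eventually.of_forall hdom)).trans hB,
    (norm_integral_le_of_norm_le hint (Eventually.of_forall hdom)).trans hB⟩

/-- **The slice estimate, `∫⁻` form** (no measurability of `g` needed):
`∫⁻ ‖𝒪_τ(x − y) g(y)‖ dy ≤ C ε τ^{-1/2} a⁻²`. [cite: KochNadirashviliSereginSverak2009, §4 (4.3)–(4.5)] -/
theorem exists_lintegral_enorm_oseenTensor_weight_le :
    ∃ C : ℝ, 0 < C ∧ ∀ {τ : ℝ}, 0 < τ → ∀ {a : ℝ}, 0 < a → ∀ {ε : ℝ}, 0 ≤ ε →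
      ∀ (g : (EuclideanSpace ℝ (Fin 3)) → (EuclideanSpace ℝ (Fin 3))), (∀ y, ‖g y‖ ≤ ε / (‖y‖ + a) ^ 3) → ∀ x : (EuclideanSpace ℝ (Fin 3)),
        ∫⁻ y, ‖oseenTensor τ (x - y) (g y)‖ₑ ≤ ENNReal.ofReal (C * ε * τ ^ (-(1 : ℝ) / 2) * (a ^ 2)⁻¹) := by
  obtain ⟨C, hC, h⟩ := exists_oseenTensor_weight_dominated
  refine ⟨C, hC, fun {τ} hτ {a} ha {ε} hε g hg x => ?_⟩
  obtain ⟨h, hint, hdom, hB⟩ := h hτ ha hε g hg x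
  have h0 : ∀ y, 0 ≤ h y := fun y => (norm_nonneg _).trans (hdom y)
  calc ∫⁻ y, ‖oseenTensor τ (x - y) (g y)‖ₑ ≤ ∫⁻ y, ENNReal.ofReal (h y) := by
        refine lintegral_mono fun y => ?_
        rw [← ofReal_norm]
        exact ENNReal.ofReal_le_ofReal (hdom y)
    _ = ENNReal.ofReal (∫ y, h y) :=
        (ofReal_integral_eq_lintegral_ofReal hint (Eventually.of_forall h0)).symm
    _ ≤ ENNReal.ofReal (C * ε * τ ^ (-(1 : ℝ) / 2) * (a ^ 2)⁻¹) := ENNReal.ofReal_le_ofReal hB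

end SliceBound

/-! ### The `O(√lag)` bound for Type-I-weighted forces on the past -/

section PastBound

/-- **The `O(√lag)` bound of the Oseen-tensor force term for a Type-I-weighted force on the
past.** There is a universal `κ > 0` such that for every `ν > 0`, every force `g` on `(−∞,0) × (EuclideanSpace ℝ (Fin 3))`
with the scale-invariant bound `‖g(τ, y)‖ ≤ ε (‖y‖ + √(−τ))⁻³` (the weight of `(u·∇)u` for a
Type-I field, KNSS 2009 (1.6)), all `s < t < 0` and all `x`:
`‖oseenForceDuhamel ν s g t x‖ ≤ κ ε √(t − s) / (√ν (−t))`.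
Proof: slice by slice `‖∫ 𝒪_{ν(t−τ)}(x−y) g(τ,y) dy‖ ≤ C ε (ν(t−τ))^{-1/2} (−τ)⁻¹`
(`exists_integral_oseenTensor_weight_le` with `a = √(−τ)`), `(−τ)⁻¹ ≤ (−t)⁻¹`, and
`∫ₛᵗ (t−τ)^{-1/2} dτ = 2√(t−s)`. No measurability of `g` is needed (the Bochner integral of a
non-integrable slice is `0`). [cite: KochNadirashviliSereginSverak2009, §4 (4.3)–(4.5) with §1 (1.6)] -/
theorem exists_norm_oseenForceDuhamel_le_of_weight :
    ∃ κ : ℝ, 0 < κ ∧ ∀ {ν : ℝ}, 0 < ν → ∀ {ε : ℝ} (g : ℝ → (EuclideanSpace ℝ (Fin 3)) → (EuclideanSpace ℝ (Fin 3))),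
      (∀ τ < 0, ∀ y, ‖g τ y‖ ≤ ε / (‖y‖ + Real.sqrt (-τ)) ^ 3) →
      ∀ ⦃s t : ℝ⦄, s < t → t < 0 → ∀ x : (EuclideanSpace ℝ (Fin 3)),
        ‖oseenForceDuhamel ν s g t x‖ ≤ κ * ε * Real.sqrt (t - s) / (Real.sqrt ν * (-t)) := by
  obtain ⟨C, hC, hslice⟩ := exists_integral_oseenTensor_weight_le
  refine ⟨2 * C, by positivity, fun {ν} hν {ε} g hg s t hst ht x => ?_⟩
  -- `ε ≥ 0` is forced by the weight hypothesis
  have hε : 0 ≤ ε := by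
    have h1 := (norm_nonneg _).trans (hg (-1) (by norm_num) 0)
    have h2 : (0 : ℝ) < (‖(0 : (EuclideanSpace ℝ (Fin 3)))‖ + Real.sqrt (-(-1 : ℝ))) ^ 3 := by simp
    exact (div_nonneg_iff.1 h1).elim (fun h => h.1) fun h => absurd h.2 (not_le.2 h2)
  have ht0 : 0 < -t := neg_pos.2 ht
  have hν' : 0 < Real.sqrt ν := Real.sqrt_pos.2 hν
  rw [oseenForceDuhamel_apply]
  -- the slice majorant `K (t − τ)^{-1/2}`
  set K : ℝ := C * ε * (Real.sqrt ν)⁻¹ * (-t)⁻¹ with hK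
  have hK0 : 0 ≤ K := by rw [hK]; positivity
  have hbound : ∀ τ ∈ Ioo s t,
      ‖∫ y, oseenTensor (ν * (t - τ)) (x - y) (g τ y)‖ ≤ K * (t - τ) ^ (-(1 / 2 : ℝ)) := by
    intro τ hτ
    have hτ0 : τ < 0 := hτ.2.trans ht
    have hτt : 0 < t - τ := sub_pos.2 hτ.2
    have hlag : 0 < ν * (t - τ) := mul_pos hν hτt
    have ha : 0 < Real.sqrt (-τ) := Real.sqrt_pos.2 (neg_pos.2 hτ0)
    have h1 := (hslice hlag ha hε (g τ) (hg τ hτ0) x).2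
    rw [Real.sq_sqrt (neg_pos.2 hτ0).le] at h1
    have hinv : (-τ)⁻¹ ≤ (-t)⁻¹ := inv_anti₀ ht0 (by linarith [hτ.2])
    have hpow : (ν * (t - τ)) ^ (-(1 : ℝ) / 2) = (Real.sqrt ν)⁻¹ * (t - τ) ^ (-(1 / 2 : ℝ)) := by
      rw [Real.mul_rpow hν.le hτt.le, show (-(1 : ℝ) / 2) = -(1 / 2 : ℝ) by norm_num,
        Real.rpow_neg hν.le, Real.sqrt_eq_rpow]
    calc ‖∫ y, oseenTensor (ν * (t - τ)) (x - y) (g τ y)‖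
        ≤ C * ε * (ν * (t - τ)) ^ (-(1 : ℝ) / 2) * (-τ)⁻¹ := h1
      _ = C * ε * (Real.sqrt ν)⁻¹ * (-τ)⁻¹ * (t - τ) ^ (-(1 / 2 : ℝ)) := by rw [hpow]; ring
      _ ≤ C * ε * (Real.sqrt ν)⁻¹ * (-t)⁻¹ * (t - τ) ^ (-(1 / 2 : ℝ)) := by
          have h0 : 0 ≤ (t - τ) ^ (-(1 / 2 : ℝ)) := Real.rpow_nonneg hτt.le _
          have h3 : 0 ≤ C * ε * (Real.sqrt ν)⁻¹ := by positivity
          nlinarith [mul_le_mul_of_nonneg_left hinv h3]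
      _ = K * (t - τ) ^ (-(1 / 2 : ℝ)) := by rw [hK]
  -- integrate the majorant over `(s, t)`
  have hint : IntegrableOn (fun τ : ℝ => K * (t - τ) ^ (-(1 / 2 : ℝ))) (Ioo s t) :=
    (integrableOn_sub_rpow_Ioo (by norm_num)).const_mul K
  calc ‖∫ τ in Ioo s t, ∫ y, oseenTensor (ν * (t - τ)) (x - y) (g τ y)‖
      ≤ ∫ τ in Ioo s t, K * (t - τ) ^ (-(1 / 2 : ℝ)) :=
        norm_integral_le_of_norm_le hint
          ((ae_restrict_iff' measurableSet_Ioo).2 (Eventually.of_forall hbound))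
    _ = K * (2 * (t - s) ^ (1 / 2 : ℝ)) := by
        rw [integral_const_mul, setIntegral_Ioo_sub_rpow_neg_half hst.le]
    _ = 2 * C * ε * Real.sqrt (t - s) / (Real.sqrt ν * (-t)) := by
        rw [hK, Real.sqrt_eq_rpow (t - s)]
        field_simp

/-- **Time-profile form** (the shape consumed by the forced compactness engine
`exists_oseenMild_limit_of_forced`, `AncientMildCompactnessForced.lean`): with
`Φ(t) = κ/(√ν (−t))`, monotone and nonnegative on `(−∞, 0)`,
`‖oseenForceDuhamel ν s g t x‖ ≤ ε Φ(t) √(t − s)` for all `s < t < 0`.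
[cite: KochNadirashviliSereginSverak2009, §4 (4.3)–(4.5) with §1 (1.6)] -/
theorem exists_profile_norm_oseenForceDuhamel_le {ν : ℝ} (hν : 0 < ν) :
    ∃ Φ : ℝ → ℝ, MonotoneOn Φ (Iio 0) ∧ (∀ t < 0, 0 ≤ Φ t) ∧
      ∀ {ε : ℝ} (g : ℝ → (EuclideanSpace ℝ (Fin 3)) → (EuclideanSpace ℝ (Fin 3))),
        (∀ τ < 0, ∀ y, ‖g τ y‖ ≤ ε / (‖y‖ + Real.sqrt (-τ)) ^ 3) →
        ∀ ⦃s t : ℝ⦄, s < t → t < 0 → ∀ x : (EuclideanSpace ℝ (Fin 3)),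
          ‖oseenForceDuhamel ν s g t x‖ ≤ ε * Φ t * Real.sqrt (t - s) := by
  obtain ⟨κ, hκ, h⟩ := exists_norm_oseenForceDuhamel_le_of_weight
  have hν' : 0 < Real.sqrt ν := Real.sqrt_pos.2 hν
  refine ⟨fun t => κ / (Real.sqrt ν * (-t)), ?_, ?_, fun {ε} g hg s t hst ht x => ?_⟩
  · intro a ha b hb hab
    have ha' : 0 < -a := neg_pos.2 ha
    have hb' : 0 < -b := neg_pos.2 hb
    exact div_le_div_of_nonneg_left hκ.le (mul_pos hν' hb') (by nlinarith)
  · intro t ht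
    have ht' : 0 < -t := neg_pos.2 ht
    positivity
  · have h1 := h hν g hg hst ht x
    calc ‖oseenForceDuhamel ν s g t x‖ ≤ κ * ε * Real.sqrt (t - s) / (Real.sqrt ν * (-t)) := h1
      _ = ε * (κ / (Real.sqrt ν * (-t))) * Real.sqrt (t - s) := by ring

end PastBound

/-! ### Joint measurability of the Oseen tensor in `(τ, z, a)` -/

section Measurability

variable {E : Type*} [NormedAddCommGroup E] [InnerProductSpace ℝ E] [FiniteDimensional ℝ E]
  [MeasurableSpace E] [BorelSpace E]

omit [FiniteDimensional ℝ E] in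
/-- **The Gaussian weight `A₁` of the Oseen tensor is jointly measurable** in `(τ, z)` on all of
`ℝ × E` (junk values at `τ ≤ 0` included; the weights of the kernel of `e^{τΔ}ℙ`, Koch–Tataru 2001,
§2 (6)–(8); the tree's `stronglyMeasurable_setIntegral_Ioi_heatKernel_div`).
[cite: KochTataruAdvMath2001, §2 (6)–(8)] -/
theorem measurable_oseenWeightA1_uncurry : Measurable fun p : ℝ × E => oseenWeightA1 p.1 p.2 := by
  unfold oseenWeightA1
  exact (stronglyMeasurable_setIntegral_Ioi_heatKernel_div 2 1).measurable

/-- **The Oseen tensor is jointly (strongly) measurable in `(τ, z, a) ∈ ℝ × E × E`** (junk values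
at `τ ≤ 0` included): an algebraic expression in the measurable weights `G_τ(z)`, `A₁(τ,z)`,
`A(τ,z)` and the inner product (the kernel of `e^{τΔ}ℙ`, Koch–Tataru 2001, §2 (6)–(8); companion
of the tree's `measurable_oseenKernel`). [cite: KochTataruAdvMath2001, §2 (6)–(8)] -/
theorem stronglyMeasurable_oseenTensor_uncurry :
    StronglyMeasurable fun p : ℝ × E × E => oseenTensor p.1 p.2.1 p.2.2 := by
  have hτz : Measurable fun p : ℝ × E × E => ((p.1, p.2.1) : ℝ × E) :=
    measurable_fst.prodMk (measurable_fst.comp measurable_snd)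
  have hG : StronglyMeasurable fun p : ℝ × E × E => UnboundedOperators.heatKernel p.1 p.2.1 :=
    (measurable_heatKernel_uncurry.comp hτz).stronglyMeasurable
  have hA1 : StronglyMeasurable fun p : ℝ × E × E => oseenWeightA1 p.1 p.2.1 :=
    (measurable_oseenWeightA1_uncurry.comp hτz).stronglyMeasurable
  have hA : StronglyMeasurable fun p : ℝ × E × E => oseenWeightA p.1 p.2.1 :=
    (stronglyMeasurable_oseenWeightA.measurable.comp hτz).stronglyMeasurable
  have hz : StronglyMeasurable fun p : ℝ × E × E => p.2.1 :=
    (measurable_fst.comp measurable_snd).stronglyMeasurable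
  have ha : StronglyMeasurable fun p : ℝ × E × E => p.2.2 :=
    (measurable_snd.comp measurable_snd).stronglyMeasurable
  have h1 : StronglyMeasurable fun p : ℝ × E × E =>
      (UnboundedOperators.heatKernel p.1 p.2.1 - oseenWeightA1 p.1 p.2.1) • p.2.2 :=
    (hG.sub hA1).smul ha
  have h2 : StronglyMeasurable fun p : ℝ × E × E =>
      (oseenWeightA p.1 p.2.1 * ⟪p.2.1, p.2.2⟫) • p.2.1 := (hA.mul (hz.inner ha)).smul hz
  exact h1.add h2

/-- **The Oseen tensor is jointly measurable in `(τ, z, a)`** (Koch–Tataru 2001, §2 (6)–(8)).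
[cite: KochTataruAdvMath2001, §2 (6)–(8)] -/
theorem measurable_oseenTensor_uncurry :
    Measurable fun p : ℝ × E × E => oseenTensor p.1 p.2.1 p.2.2 :=
  stronglyMeasurable_oseenTensor_uncurry.measurable

/-- A force jointly continuous on the open past `(−∞, 0) × E`, extended by zero, is a.e. strongly
measurable for every measure on `ℝ × E`. [folklore] -/
private theorem aestronglyMeasurable_indicator_pastForce {g : ℝ → E → E}
    (hg : ContinuousOn (uncurry g) (Iio 0 ×ˢ univ)) (μ : Measure (ℝ × E)) :
    AEStronglyMeasurable ((Iio (0 : ℝ) ×ˢ (univ : Set E)).indicator (uncurry g)) μ := by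
  have hs : MeasurableSet (Iio (0 : ℝ) ×ˢ (univ : Set E)) :=
    measurableSet_Iio.prod MeasurableSet.univ
  exact (aestronglyMeasurable_indicator_iff hs).2 (hg.aestronglyMeasurable hs)

/-- **Measurability of the Duhamel integrand `(τ, y) ↦ 𝒪_{ν(t−τ)}(x − y) g(τ, y)`** (the force
extended by zero off the open past) for every measure on `ℝ × E`. [folklore] -/
private theorem aestronglyMeasurable_oseenTensor_indicator_pastForce {g : ℝ → E → E}
    (hg : ContinuousOn (uncurry g) (Iio 0 ×ˢ univ)) (μ : Measure (ℝ × E)) (ν t : ℝ) (x : E) :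
    AEStronglyMeasurable (fun q : ℝ × E => oseenTensor (ν * (t - q.1)) (x - q.2)
      ((Iio (0 : ℝ) ×ˢ (univ : Set E)).indicator (uncurry g) q)) μ := by
  have h1 := aestronglyMeasurable_indicator_pastForce hg μ
  have hF : AEMeasurable (fun q : ℝ × E => ((ν * (t - q.1), x - q.2,
      (Iio (0 : ℝ) ×ˢ (univ : Set E)).indicator (uncurry g) q) : ℝ × E × E)) μ :=
    (measurable_const.mul (measurable_const.sub measurable_fst)).aemeasurable.prodMk
      ((measurable_const.sub measurable_snd).aemeasurable.prodMk h1.aemeasurable)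
  exact (measurable_oseenTensor_uncurry.comp_aemeasurable hF).aestronglyMeasurable

omit [InnerProductSpace ℝ E] [FiniteDimensional ℝ E] [MeasurableSpace E] [BorelSpace E] in
/-- On the past the zero extension agrees with the force. [folklore] -/
private theorem indicator_pastForce_of_neg {g : ℝ → E → E} {τ : ℝ} (hτ : τ < 0) (y : E) :
    (Iio (0 : ℝ) ×ˢ (univ : Set E)).indicator (uncurry g) (τ, y) = g τ y := by
  rw [Set.indicator_of_mem (Set.mk_mem_prod (show τ ∈ Iio (0 : ℝ) from hτ) (Set.mem_univ y))]
  rfl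

end Measurability

/-! ### Continuity of the slice potential and of the force term in space -/

section Continuity

/-- **The slice potential `x ↦ ∫ 𝒪_σ(x − y) g₀(y) dy` is continuous** for `σ > 0` and a
continuous force with the scale weight `‖g₀(y)‖ ≤ ε (‖y‖ + a)⁻³` (dominated convergence in `y`
with the locally uniform majorant `8 C₀ (σ + ‖x₀−y‖²)^{-3/2} + C₀ σ^{-3/2} 1_{B(x₀,2)}` times the
weight). [cite: LemarieRieusset2016, §6.2] -/
theorem continuous_integral_oseenTensor_sub_of_weight {σ a ε : ℝ} (hσ : 0 < σ) (ha : 0 < a)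
    {g₀ : (EuclideanSpace ℝ (Fin 3)) → (EuclideanSpace ℝ (Fin 3))} (hgc : Continuous g₀)
    (hg : ∀ y, ‖g₀ y‖ ≤ ε / (‖y‖ + a) ^ 3) :
    Continuous fun x : (EuclideanSpace ℝ (Fin 3)) => ∫ y, oseenTensor σ (x - y) (g₀ y) := by
  have hE : 0 < Module.finrank ℝ (EuclideanSpace ℝ (Fin 3)) := by
    rw [finrank_euclideanSpace_fin]; norm_num
  have hd3 : (Module.finrank ℝ (EuclideanSpace ℝ (Fin 3)) : ℝ) = 3 := by
    rw [finrank_euclideanSpace_fin]; norm_num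
  obtain ⟨C₀, hC₀, hO⟩ := exists_norm_oseenTensor_le (E := EuclideanSpace ℝ (Fin 3)) hE
  have hε : 0 ≤ ε := by
    have h1 := (norm_nonneg _).trans (hg 0)
    have h2 : (0 : ℝ) < (‖(0 : EuclideanSpace ℝ (Fin 3))‖ + a) ^ 3 := by simp [ha]
    exact (div_nonneg_iff.1 h1).elim (fun h => h.1) fun h => absurd h.2 (not_le.2 h2)
  refine continuous_iff_continuousAt.2 fun x₀ => ?_
  -- the majorants at `x₀`
  set k₀ : (EuclideanSpace ℝ (Fin 3)) → ℝ := fun y => (σ + ‖x₀ - y‖ ^ 2) ^ (-(3 : ℝ) / 2) with hk₀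
  set m : (EuclideanSpace ℝ (Fin 3)) → ℝ := fun y => ε / (‖y‖ + a) ^ 3 with hm
  obtain ⟨hkp, -⟩ := memLp_kernelMajorant hσ x₀
  obtain ⟨hmp, -⟩ := memLp_forceMajorant ha hε
  haveI := oseenForce_holderTriple_threeHalves_three
  have hkm : Integrable (fun y => k₀ y * m y) := hkp.integrable_mul hmp
  have hσ0 : 0 ≤ σ ^ (-(3 : ℝ) / 2) := Real.rpow_nonneg hσ.le _
  set bound : (EuclideanSpace ℝ (Fin 3)) → ℝ := fun y =>
    C₀ * (8 * (k₀ y * m y)) +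
      (ball x₀ 2).indicator (fun _ => C₀ * σ ^ (-(3 : ℝ) / 2) * (ε / a ^ 3)) y with hbound
  have hbint : Integrable bound := by
    refine ((hkm.const_mul 8).const_mul C₀).add ?_
    exact (integrableOn_const (measure_ball_lt_top (μ := volume) (x := x₀) (r := 2)).ne).integrable_indicator
      measurableSet_ball
  refine continuousAt_of_dominated (bound := bound) ?_ ?_ hbint ?_
  · exact Eventually.of_forall fun x =>
      (continuous_oseenTensor_sub_apply hE hσ hgc x).aestronglyMeasurable
  · -- the locally uniform bound, for `x ∈ B(x₀, 1)`
    have hnhds : ∀ᶠ x in 𝓝 x₀, dist x x₀ < 1 := Metric.ball_mem_nhds x₀ one_pos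
    filter_upwards [hnhds] with x hx
    refine Eventually.of_forall fun y => ?_
    have h1 := hO hσ (x - y) (g₀ y)
    rw [hd3] at h1
    have hmy : ‖g₀ y‖ ≤ m y := hg y
    have hm0 : 0 ≤ m y := by positivity
    have hxx : ‖x - x₀‖ < 1 := by rwa [← dist_eq_norm]
    have hk0 : 0 ≤ k₀ y := by positivity
    -- compare the kernels at `x` and `x₀`
    have hker : (σ + ‖x - y‖ ^ 2) ^ (-((3 : ℝ) / 2)) ≤
        8 * k₀ y + (ball x₀ 2).indicator (fun _ => σ ^ (-(3 : ℝ) / 2)) y := by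
      by_cases hy : y ∈ ball x₀ 2
      · rw [Set.indicator_of_mem hy]
        have hle : (σ + ‖x - y‖ ^ 2) ^ (-((3 : ℝ) / 2)) ≤ σ ^ (-(3 : ℝ) / 2) := by
          rw [show (-(3 : ℝ) / 2) = -((3 : ℝ) / 2) by ring]
          exact Real.rpow_le_rpow_of_nonpos hσ (by nlinarith [norm_nonneg (x - y)]) (by norm_num)
        linarith
      · rw [Set.indicator_of_notMem hy, add_zero]
        have hy2 : 2 ≤ ‖x₀ - y‖ := by
          rw [mem_ball, dist_comm, dist_eq_norm, not_lt] at hy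
          exact hy
        have hxy : ‖x₀ - y‖ / 2 ≤ ‖x - y‖ := by
          have := norm_sub_le_norm_sub_add_norm_sub x₀ x y
          rw [norm_sub_rev x₀ x] at this
          linarith
        have hq : (σ + ‖x₀ - y‖ ^ 2) / 4 ≤ σ + ‖x - y‖ ^ 2 := by
          have h0 : 0 ≤ ‖x₀ - y‖ / 2 := by positivity
          nlinarith [mul_self_le_mul_self h0 hxy, hσ.le]
        have hpos : 0 < (σ + ‖x₀ - y‖ ^ 2) / 4 := by positivity
        calc (σ + ‖x - y‖ ^ 2) ^ (-((3 : ℝ) / 2))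
            ≤ ((σ + ‖x₀ - y‖ ^ 2) / 4) ^ (-((3 : ℝ) / 2)) :=
              Real.rpow_le_rpow_of_nonpos hpos hq (by norm_num)
          _ = 8 * k₀ y := by
              rw [hk₀, div_eq_mul_inv, Real.mul_rpow (by positivity) (by norm_num),
                show (-(3 : ℝ) / 2) = -((3 : ℝ) / 2) by ring]
              have h8 : ((4 : ℝ)⁻¹) ^ (-((3 : ℝ) / 2)) = 8 := by
                rw [Real.inv_rpow (by norm_num), Real.rpow_neg (by norm_num), inv_inv,
                  show (4 : ℝ) = 2 ^ (2 : ℝ) by norm_num, ← Real.rpow_mul (by norm_num)]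
                norm_num
              rw [h8]
              ring
    have hsum0 : 0 ≤ 8 * k₀ y + (ball x₀ 2).indicator (fun _ => σ ^ (-(3 : ℝ) / 2)) y :=
      add_nonneg (by positivity) (Set.indicator_nonneg (fun _ _ => hσ0) _)
    calc ‖oseenTensor σ (x - y) (g₀ y)‖ ≤ C₀ * (σ + ‖x - y‖ ^ 2) ^ (-((3 : ℝ) / 2)) * ‖g₀ y‖ := h1
      _ ≤ C₀ * (8 * k₀ y + (ball x₀ 2).indicator (fun _ => σ ^ (-(3 : ℝ) / 2)) y) * m y :=
          mul_le_mul (mul_le_mul_of_nonneg_left hker hC₀.le) hmy (norm_nonneg _)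
            (mul_nonneg hC₀.le hsum0)
      _ ≤ bound y := by
          rw [hbound]
          by_cases hy : y ∈ ball x₀ 2
          · simp only [Set.indicator_of_mem hy]
            have hmle : m y ≤ ε / a ^ 3 := by
              rw [hm]
              exact div_le_div_of_nonneg_left hε (by positivity)
                (pow_le_pow_left₀ ha.le (by linarith [norm_nonneg y]) 3)
            nlinarith [mul_le_mul_of_nonneg_left hmle (mul_nonneg hC₀.le hσ0), hm0, hC₀.le, hk0]
          · simp only [Set.indicator_of_notMem hy, add_zero]
            nlinarith [hm0, hC₀.le, hk0]
  · refine Eventually.of_forall fun y => ?_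
    have hc : Continuous fun x : EuclideanSpace ℝ (Fin 3) => oseenTensor σ (x - y) (g₀ y) := by
      have h1 := continuous_oseenTensor_sub_apply hE hσ (continuous_const (y := g₀ y))
        (0 : EuclideanSpace ℝ (Fin 3))
      have h2 : Continuous fun x : EuclideanSpace ℝ (Fin 3) => y - x := continuous_const.sub continuous_id
      refine (h1.comp h2).congr fun x => ?_
      simp
    exact hc.continuousAt

/-- Slices of a force jointly continuous on the open past are continuous. [folklore] -/
private theorem continuous_pastForce_slice {E : Type*} [NormedAddCommGroup E] {g : ℝ → E → E}
    (hgc : ContinuousOn (uncurry g) (Iio 0 ×ˢ univ)) {τ : ℝ} (hτ : τ < 0) : Continuous (g τ) := by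
  have h1 : Continuous fun y : E => ((τ, y) : ℝ × E) := continuous_const.prodMk continuous_id
  exact (hgc.comp_continuous h1 fun y =>
    Set.mk_mem_prod (show τ ∈ Iio (0 : ℝ) from hτ) (Set.mem_univ y)).congr fun _ => rfl

/-- **The Oseen-tensor force term is continuous in space**: for `ν > 0`, `t < 0` and a force
jointly continuous on the open past with the Type-I defect weight
`‖g(τ, y)‖ ≤ ε (‖y‖ + √(−τ))⁻³`, the map `x ↦ oseenForceDuhamel ν s g t x` is continuous
(dominated convergence in `τ ∈ (s, t)` with the slice majorant `K (t − τ)^{-1/2}` of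
`exists_norm_oseenForceDuhamel_le_of_weight`, the slices being continuous in `x` by
`continuous_integral_oseenTensor_sub_of_weight`). [cite: LemarieRieusset2016, §6.2] -/
theorem continuous_oseenForceDuhamel_of_weight {ν : ℝ} (hν : 0 < ν) {ε : ℝ}
    {g : ℝ → (EuclideanSpace ℝ (Fin 3)) → (EuclideanSpace ℝ (Fin 3))}
    (hgc : ContinuousOn (uncurry g) (Iio 0 ×ˢ univ))
    (hg : ∀ τ < 0, ∀ y, ‖g τ y‖ ≤ ε / (‖y‖ + Real.sqrt (-τ)) ^ 3) (s : ℝ) {t : ℝ} (ht : t < 0) :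
    Continuous (oseenForceDuhamel ν s g t) := by
  rcases le_or_gt t s with hts | hst
  · have h0 : oseenForceDuhamel ν s g t = fun _ => 0 := funext fun x => oseenForceDuhamel_of_le hts g ▸ rfl
    rw [h0]
    exact continuous_const
  obtain ⟨C, hC, hslice⟩ := exists_integral_oseenTensor_weight_le
  have hε : 0 ≤ ε := by
    have h1 := (norm_nonneg _).trans (hg (-1) (by norm_num) 0)
    have h2 : (0 : ℝ) < (‖(0 : (EuclideanSpace ℝ (Fin 3)))‖ + Real.sqrt (-(-1 : ℝ))) ^ 3 := by simp
    exact (div_nonneg_iff.1 h1).elim (fun h => h.1) fun h => absurd h.2 (not_le.2 h2)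
  have ht0 : 0 < -t := neg_pos.2 ht
  have hν' : 0 < Real.sqrt ν := Real.sqrt_pos.2 hν
  have hrepr : oseenForceDuhamel ν s g t =
      fun x => ∫ τ in Ioo s t, ∫ y, oseenTensor (ν * (t - τ)) (x - y) (g τ y) := rfl
  rw [hrepr]
  -- the slice majorant `K (t − τ)^{-1/2}`
  set K : ℝ := C * ε * (Real.sqrt ν)⁻¹ * (-t)⁻¹ with hK
  have hbound : ∀ (x : EuclideanSpace ℝ (Fin 3)), ∀ τ ∈ Ioo s t,
      ‖∫ y, oseenTensor (ν * (t - τ)) (x - y) (g τ y)‖ ≤ K * (t - τ) ^ (-(1 / 2 : ℝ)) := by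
    intro x τ hτ
    have hτ0 : τ < 0 := hτ.2.trans ht
    have hτt : 0 < t - τ := sub_pos.2 hτ.2
    have hlag : 0 < ν * (t - τ) := mul_pos hν hτt
    have ha : 0 < Real.sqrt (-τ) := Real.sqrt_pos.2 (neg_pos.2 hτ0)
    have h1 := (hslice hlag ha hε (g τ) (hg τ hτ0) x).2
    rw [Real.sq_sqrt (neg_pos.2 hτ0).le] at h1
    have hinv : (-τ)⁻¹ ≤ (-t)⁻¹ := inv_anti₀ ht0 (by linarith [hτ.2])
    have hpow : (ν * (t - τ)) ^ (-(1 : ℝ) / 2) = (Real.sqrt ν)⁻¹ * (t - τ) ^ (-(1 / 2 : ℝ)) := by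
      rw [Real.mul_rpow hν.le hτt.le, show (-(1 : ℝ) / 2) = -(1 / 2 : ℝ) by norm_num,
        Real.rpow_neg hν.le, Real.sqrt_eq_rpow]
    calc ‖∫ y, oseenTensor (ν * (t - τ)) (x - y) (g τ y)‖
        ≤ C * ε * (ν * (t - τ)) ^ (-(1 : ℝ) / 2) * (-τ)⁻¹ := h1
      _ = C * ε * (Real.sqrt ν)⁻¹ * (-τ)⁻¹ * (t - τ) ^ (-(1 / 2 : ℝ)) := by rw [hpow]; ring
      _ ≤ C * ε * (Real.sqrt ν)⁻¹ * (-t)⁻¹ * (t - τ) ^ (-(1 / 2 : ℝ)) := by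
          have h0 : 0 ≤ (t - τ) ^ (-(1 / 2 : ℝ)) := Real.rpow_nonneg hτt.le _
          have h3 : 0 ≤ C * ε * (Real.sqrt ν)⁻¹ := by positivity
          nlinarith [mul_le_mul_of_nonneg_left hinv h3]
      _ = K * (t - τ) ^ (-(1 / 2 : ℝ)) := by rw [hK]
  have hint : IntegrableOn (fun τ : ℝ => K * (t - τ) ^ (-(1 / 2 : ℝ))) (Ioo s t) :=
    (integrableOn_sub_rpow_Ioo (by norm_num)).const_mul K
  refine continuous_of_dominated (μ := volume.restrict (Ioo s t))
    (bound := fun τ => K * (t - τ) ^ (-(1 / 2 : ℝ))) ?_ ?_ hint ?_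
  · -- measurability of the slices in `τ`
    intro x
    have h1 := (aestronglyMeasurable_oseenTensor_indicator_pastForce hgc
      ((volume.restrict (Ioo s t)).prod volume) ν t x).integral_prod_right'
    refine h1.congr ?_
    filter_upwards [ae_restrict_mem measurableSet_Ioo] with τ hτ
    show ∫ y, oseenTensor (ν * (t - τ)) (x - y)
        ((Iio (0 : ℝ) ×ˢ (univ : Set (EuclideanSpace ℝ (Fin 3)))).indicator (uncurry g) (τ, y)) =
      ∫ y, oseenTensor (ν * (t - τ)) (x - y) (g τ y)
    simp_rw [indicator_pastForce_of_neg (hτ.2.trans ht)]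
  · intro x
    exact (ae_restrict_iff' measurableSet_Ioo).2 (Eventually.of_forall (hbound x))
  · refine (ae_restrict_iff' measurableSet_Ioo).2 (Eventually.of_forall fun τ hτ => ?_)
    have hτ0 : τ < 0 := hτ.2.trans ht
    have hlag : 0 < ν * (t - τ) := mul_pos hν (sub_pos.2 hτ.2)
    have ha : 0 < Real.sqrt (-τ) := Real.sqrt_pos.2 (neg_pos.2 hτ0)
    exact continuous_integral_oseenTensor_sub_of_weight hlag ha (continuous_pastForce_slice hgc hτ0)
      (hg τ hτ0)

end Continuity

/-! ### The force term against test fields: Fubini, the adjoint identity, weak divergence freeness -/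

section Pairing

/-- The Oseen tensor is even in `z`. [folklore] -/
private theorem oseenTensor_neg_left {E : Type*} [NormedAddCommGroup E] [InnerProductSpace ℝ E]
    (τ : ℝ) (z a : E) : oseenTensor τ (-z) a = oseenTensor τ z a := by
  have hA : oseenWeightA τ (-z) = oseenWeightA τ z := by
    simp only [oseenWeightA, UnboundedOperators.heatKernel_neg]
  have hA1 : oseenWeightA1 τ (-z) = oseenWeightA1 τ z := by
    simp only [oseenWeightA1, UnboundedOperators.heatKernel_neg]
  rw [oseenTensor_apply, oseenTensor_apply, hA, hA1, UnboundedOperators.heatKernel_neg,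
    inner_neg_left, mul_neg, neg_smul, smul_neg, neg_neg]

/-- The Oseen tensor is symmetric. [folklore] -/
private theorem inner_oseenTensor_comm {E : Type*} [NormedAddCommGroup E] [InnerProductSpace ℝ E]
    (τ : ℝ) (z a w : E) : ⟪oseenTensor τ z a, w⟫ = ⟪oseenTensor τ z w, a⟫ := by
  rw [inner_oseenTensor, inner_oseenTensor, real_inner_comm a w]
  ring

/-- **The tested slice**: for a test field `G`, `σ > 0` and all `y, a`,
`∫ ⟪𝒪_σ(x − y) a, G(x)⟫ dx = ⟪a, e^{σΔ}ℙG(y)⟫` (symmetry and evenness of the tensor and the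
representation `e^{σΔ}ℙG = ∫ 𝒪_σ(· − x) G(x) dx`). [cite: LemarieRieusset2016, §6.2] -/
theorem integral_inner_oseenTensor_sub_left_eq_inner_heatExtension_classicalLerayProj
    {G : (EuclideanSpace ℝ (Fin 3)) → (EuclideanSpace ℝ (Fin 3))} (hG : ContDiff ℝ (⊤ : ℕ∞) G)
    (hGc : HasCompactSupport G) {σ : ℝ} (hσ : 0 < σ) (y a : EuclideanSpace ℝ (Fin 3)) :
    ∫ x, ⟪oseenTensor σ (x - y) a, G x⟫ =
      ⟪a, UnboundedOperators.heatExtension (classicalLerayProj G) σ y⟫ := by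
  have h1 : ∀ x, ⟪oseenTensor σ (x - y) a, G x⟫ = ⟪oseenTensor σ (y - x) (G x), a⟫ := by
    intro x
    rw [inner_oseenTensor_comm, ← neg_sub y x, oseenTensor_neg_left]
  simp_rw [h1]
  rw [← inner_heatExtension_classicalLerayProj_eq_integral_oseenTensor hG hGc hσ y a, real_inner_comm]

variable {ν ε s t : ℝ} {g : ℝ → (EuclideanSpace ℝ (Fin 3)) → (EuclideanSpace ℝ (Fin 3))}

/-- `ε ≥ 0` is forced by the defect weight. [folklore] -/
private theorem nonneg_of_pastWeight
    (hg : ∀ τ < 0, ∀ y, ‖g τ y‖ ≤ ε / (‖y‖ + Real.sqrt (-τ)) ^ 3) : 0 ≤ ε := by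
  have h1 := (norm_nonneg _).trans (hg (-1) (by norm_num) 0)
  have h2 : (0 : ℝ) < (‖(0 : (EuclideanSpace ℝ (Fin 3)))‖ + Real.sqrt (-(-1 : ℝ))) ^ 3 := by simp
  exact (div_nonneg_iff.1 h1).elim (fun h => h.1) fun h => absurd h.2 (not_le.2 h2)

/-- **`∫⁻` majorant of the force Duhamel integrand on the past**: with a universal `κ`,
`∫⁻_{(s,t)} ∫⁻ ‖𝒪_{ν(t−τ)}(x − y) g(τ, y)‖ dy dτ ≤ κ ε √(t − s)/(√ν (−t))` for every force with
the Type-I defect weight (no measurability needed). [cite: KochNadirashviliSereginSverak2009, §4 (4.3)–(4.5) with §1 (1.6)] -/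
theorem exists_lintegral_enorm_oseenTensor_pastForce_le :
    ∃ κ : ℝ, 0 < κ ∧ ∀ {ν : ℝ}, 0 < ν →
      ∀ {ε : ℝ} (g : ℝ → (EuclideanSpace ℝ (Fin 3)) → (EuclideanSpace ℝ (Fin 3))),
      (∀ τ < 0, ∀ y, ‖g τ y‖ ≤ ε / (‖y‖ + Real.sqrt (-τ)) ^ 3) →
      ∀ ⦃s t : ℝ⦄, s < t → t < 0 → ∀ x : (EuclideanSpace ℝ (Fin 3)),
        ∫⁻ τ in Ioo s t, ∫⁻ y, ‖oseenTensor (ν * (t - τ)) (x - y) (g τ y)‖ₑ ≤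
          ENNReal.ofReal (κ * ε * Real.sqrt (t - s) / (Real.sqrt ν * (-t))) := by
  obtain ⟨C, hC, hslice⟩ := exists_lintegral_enorm_oseenTensor_weight_le
  refine ⟨2 * C, by positivity, fun {ν} hν {ε} g hg s t hst ht x => ?_⟩
  have hε : 0 ≤ ε := nonneg_of_pastWeight hg
  have ht0 : 0 < -t := neg_pos.2 ht
  have hν' : 0 < Real.sqrt ν := Real.sqrt_pos.2 hν
  set K : ℝ := C * ε * (Real.sqrt ν)⁻¹ * (-t)⁻¹ with hK
  have hK0 : 0 ≤ K := by rw [hK]; positivity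
  have hbound : ∀ τ ∈ Ioo s t,
      ∫⁻ y, ‖oseenTensor (ν * (t - τ)) (x - y) (g τ y)‖ₑ ≤
        ENNReal.ofReal (K * (t - τ) ^ (-(1 / 2 : ℝ))) := by
    intro τ hτ
    have hτ0 : τ < 0 := hτ.2.trans ht
    have hτt : 0 < t - τ := sub_pos.2 hτ.2
    have hlag : 0 < ν * (t - τ) := mul_pos hν hτt
    have ha : 0 < Real.sqrt (-τ) := Real.sqrt_pos.2 (neg_pos.2 hτ0)
    refine (hslice hlag ha hε (g τ) (hg τ hτ0) x).trans (ENNReal.ofReal_le_ofReal ?_)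
    rw [Real.sq_sqrt (neg_pos.2 hτ0).le]
    have hinv : (-τ)⁻¹ ≤ (-t)⁻¹ := inv_anti₀ ht0 (by linarith [hτ.2])
    have hpow : (ν * (t - τ)) ^ (-(1 : ℝ) / 2) = (Real.sqrt ν)⁻¹ * (t - τ) ^ (-(1 / 2 : ℝ)) := by
      rw [Real.mul_rpow hν.le hτt.le, show (-(1 : ℝ) / 2) = -(1 / 2 : ℝ) by norm_num,
        Real.rpow_neg hν.le, Real.sqrt_eq_rpow]
    calc C * ε * (ν * (t - τ)) ^ (-(1 : ℝ) / 2) * (-τ)⁻¹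
        = C * ε * (Real.sqrt ν)⁻¹ * (-τ)⁻¹ * (t - τ) ^ (-(1 / 2 : ℝ)) := by rw [hpow]; ring
      _ ≤ C * ε * (Real.sqrt ν)⁻¹ * (-t)⁻¹ * (t - τ) ^ (-(1 / 2 : ℝ)) := by
          have h0 : 0 ≤ (t - τ) ^ (-(1 / 2 : ℝ)) := Real.rpow_nonneg hτt.le _
          have h3 : 0 ≤ C * ε * (Real.sqrt ν)⁻¹ := by positivity
          nlinarith [mul_le_mul_of_nonneg_left hinv h3]
      _ = K * (t - τ) ^ (-(1 / 2 : ℝ)) := by rw [hK]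
  calc ∫⁻ τ in Ioo s t, ∫⁻ y, ‖oseenTensor (ν * (t - τ)) (x - y) (g τ y)‖ₑ
      ≤ ∫⁻ τ in Ioo s t, ENNReal.ofReal (K * (t - τ) ^ (-(1 / 2 : ℝ))) :=
        lintegral_mono_ae ((ae_restrict_iff' measurableSet_Ioo).2 (Eventually.of_forall hbound))
    _ = ∫⁻ τ in Ioo s t, ENNReal.ofReal K * ENNReal.ofReal ((t - τ) ^ (-(1 / 2 : ℝ))) := by
        refine lintegral_congr fun τ => ?_
        rw [ENNReal.ofReal_mul hK0]
    _ = ENNReal.ofReal K * ENNReal.ofReal (2 * Real.sqrt (t - s)) := by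
        rw [lintegral_const_mul' _ _ ENNReal.ofReal_ne_top, setLIntegral_Ioo_sub_rpow_neg_half_of_lt hst]
    _ = ENNReal.ofReal (2 * C * ε * Real.sqrt (t - s) / (Real.sqrt ν * (-t))) := by
        rw [← ENNReal.ofReal_mul hK0, hK]
        congr 1
        field_simp

/-- The force Duhamel integrand `(x, (τ, y)) ↦ 𝒪_{ν(t−τ)}(x − y) g(τ, y)` is a.e. strongly
measurable on `E × ((s, t) × E)` (`t ≤ 0`) for a force jointly continuous on the open past.
[folklore] -/
private theorem aestronglyMeasurable_oseenTensor_pastForce_prod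
    (hgc : ContinuousOn (uncurry g) (Iio 0 ×ˢ univ)) (ν : ℝ) {s t : ℝ} (ht : t ≤ 0) :
    AEStronglyMeasurable (fun q : (EuclideanSpace ℝ (Fin 3)) × (ℝ × (EuclideanSpace ℝ (Fin 3))) =>
        oseenTensor (ν * (t - q.2.1)) (q.1 - q.2.2) (g q.2.1 q.2.2))
      ((volume : Measure (EuclideanSpace ℝ (Fin 3))).prod
        ((volume : Measure (ℝ × (EuclideanSpace ℝ (Fin 3)))).restrict (Ioo s t ×ˢ univ))) := by
  set μ : Measure (ℝ × (EuclideanSpace ℝ (Fin 3))) :=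
    (volume : Measure (ℝ × (EuclideanSpace ℝ (Fin 3)))).restrict (Ioo s t ×ˢ univ) with hμ
  set gbar : ℝ × (EuclideanSpace ℝ (Fin 3)) → (EuclideanSpace ℝ (Fin 3)) :=
    (Iio (0 : ℝ) ×ˢ (univ : Set (EuclideanSpace ℝ (Fin 3)))).indicator (uncurry g) with hgbar
  have hgm : AEStronglyMeasurable gbar μ := aestronglyMeasurable_indicator_pastForce hgc μ
  have hF : AEMeasurable (fun q : (EuclideanSpace ℝ (Fin 3)) × (ℝ × (EuclideanSpace ℝ (Fin 3))) =>
      ((ν * (t - q.2.1), q.1 - q.2.2, gbar q.2) :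
        ℝ × (EuclideanSpace ℝ (Fin 3)) × (EuclideanSpace ℝ (Fin 3))))
      ((volume : Measure (EuclideanSpace ℝ (Fin 3))).prod μ) :=
    (measurable_const.mul (measurable_const.sub (measurable_fst.comp measurable_snd))).aemeasurable.prodMk
      ((measurable_fst.sub (measurable_snd.comp measurable_snd)).aemeasurable.prodMk
        (hgm.comp_snd (μ := (volume : Measure (EuclideanSpace ℝ (Fin 3))))).aemeasurable)
  have h1 := (measurable_oseenTensor_uncurry.comp_aemeasurable hF).aestronglyMeasurable
  refine h1.congr ?_
  -- a.e. on the product the time variable lies in `(s, t) ⊆ (−∞, 0)`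
  have hae : ∀ᵐ q ∂((volume : Measure (EuclideanSpace ℝ (Fin 3))).prod μ),
      q.2 ∈ Ioo s t ×ˢ (univ : Set (EuclideanSpace ℝ (Fin 3))) := by
    refine ae_of_ae_map measurable_snd.aemeasurable ?_
    rw [Measure.map_snd_prod]
    exact Measure.ae_smul_measure (ae_restrict_mem (measurableSet_Ioo.prod MeasurableSet.univ)) _
  filter_upwards [hae] with q hq
  have hq0 : q.2.1 < 0 := (mem_prod.1 hq).1.2.trans_le ht
  simp only [Function.comp_apply, hgbar]
  rw [Set.indicator_of_mem (Set.mk_mem_prod (show q.2.1 ∈ Iio (0 : ℝ) from hq0) (Set.mem_univ q.2.2))]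
  rfl

/-- **Absolute convergence of the force term**: for `ν > 0`, `s < t < 0` and a force jointly
continuous on the open past with the defect weight, the integrand of `oseenForceDuhamel ν s g t x`
is integrable on `(s, t) × E`. [cite: KochNadirashviliSereginSverak2009, §4 (4.3)–(4.5)] -/
theorem integrable_oseenTensor_pastForce (hν : 0 < ν)
    (hgc : ContinuousOn (uncurry g) (Iio 0 ×ˢ univ))
    (hg : ∀ τ < 0, ∀ y, ‖g τ y‖ ≤ ε / (‖y‖ + Real.sqrt (-τ)) ^ 3) (hst : s < t) (ht : t < 0)
    (x : EuclideanSpace ℝ (Fin 3)) :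
    Integrable (fun p : ℝ × (EuclideanSpace ℝ (Fin 3)) =>
        oseenTensor (ν * (t - p.1)) (x - p.2) (g p.1 p.2))
      ((volume : Measure (ℝ × (EuclideanSpace ℝ (Fin 3)))).restrict (Ioo s t ×ˢ univ)) := by
  obtain ⟨κ, hκ, hmaj⟩ := exists_lintegral_enorm_oseenTensor_pastForce_le
  set μ : Measure (ℝ × (EuclideanSpace ℝ (Fin 3))) :=
    (volume : Measure (ℝ × (EuclideanSpace ℝ (Fin 3)))).restrict (Ioo s t ×ˢ univ) with hμ
  have h1 := aestronglyMeasurable_oseenTensor_indicator_pastForce hgc μ ν t x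
  have hmeas : AEStronglyMeasurable (fun p : ℝ × (EuclideanSpace ℝ (Fin 3)) =>
      oseenTensor (ν * (t - p.1)) (x - p.2) (g p.1 p.2)) μ := by
    refine h1.congr ?_
    filter_upwards [ae_restrict_mem (measurableSet_Ioo.prod MeasurableSet.univ)] with p hp
    have hp0 : p.1 < 0 := (mem_prod.1 hp).1.2.trans ht
    show oseenTensor (ν * (t - p.1)) (x - p.2)
        ((Iio (0 : ℝ) ×ˢ (univ : Set (EuclideanSpace ℝ (Fin 3)))).indicator (uncurry g) p) =
      oseenTensor (ν * (t - p.1)) (x - p.2) (g p.1 p.2)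
    rw [Set.indicator_of_mem (Set.mk_mem_prod (show p.1 ∈ Iio (0 : ℝ) from hp0) (Set.mem_univ p.2))]
    rfl
  refine ⟨hmeas, ?_⟩
  rw [hasFiniteIntegral_iff_enorm, hμ, volume_restrict_prod_univ_eq_prod]
  exact lt_of_le_of_lt ((lintegral_prod_le _).trans (hmaj hν g hg hst ht x)) ENNReal.ofReal_lt_top

/-- **The force term as a product integral** (Fubini, from the absolute convergence (4.5) of
KNSS 2009, §4): `oseenForceDuhamel ν s g t x = ∫_{(s,t) × E} 𝒪_{ν(t−τ)}(x − y) g(τ, y) d(τ, y)`.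
[cite: KochNadirashviliSereginSverak2009, §4 (4.3)–(4.5)] -/
theorem oseenForceDuhamel_eq_integral_prod (hν : 0 < ν)
    (hgc : ContinuousOn (uncurry g) (Iio 0 ×ˢ univ))
    (hg : ∀ τ < 0, ∀ y, ‖g τ y‖ ≤ ε / (‖y‖ + Real.sqrt (-τ)) ^ 3) (hst : s < t) (ht : t < 0)
    (x : EuclideanSpace ℝ (Fin 3)) :
    oseenForceDuhamel ν s g t x =
      ∫ p in Ioo s t ×ˢ univ, oseenTensor (ν * (t - p.1)) (x - p.2) (g p.1 p.2)
        ∂(volume : Measure (ℝ × (EuclideanSpace ℝ (Fin 3)))) := by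
  have hint := integrable_oseenTensor_pastForce hν hgc hg hst ht x
  rw [volume_restrict_prod_univ_eq_prod] at hint ⊢
  rw [oseenForceDuhamel_apply, integral_prod _ hint]

/-- **The force term against a continuous compactly supported field is the space–time integral
of the tested kernel** (Fubini over `E × ((s,t) × E)` under the majorant
`∫ |w| ∫⁻∫⁻ |𝒪 g| ≤ ‖w‖₁ κ ε √(t−s)/(√ν(−t))`):
`∫ ⟪oseenForceDuhamel ν s g t, w⟫ = ∫_{(s,t)×E} (∫ ⟪𝒪_{ν(t−τ)}(x−y) g(τ,y), w(x)⟫ dx) d(τ,y)` — the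
Fubini step of the passage between the Oseen (mild) and the tested (very weak) forms,
Lemarié-Rieusset 2016, proof of Thm. 6.1. [cite: LemarieRieusset2016, Thm. 6.1 ((6.12) ⇒ (6.11))] -/
theorem integral_inner_oseenForceDuhamel_eq_setIntegral (hν : 0 < ν)
    (hgc : ContinuousOn (uncurry g) (Iio 0 ×ˢ univ))
    (hg : ∀ τ < 0, ∀ y, ‖g τ y‖ ≤ ε / (‖y‖ + Real.sqrt (-τ)) ^ 3) (hst : s < t) (ht : t < 0)
    {w : (EuclideanSpace ℝ (Fin 3)) → (EuclideanSpace ℝ (Fin 3))} (hw : Continuous w)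
    (hwc : HasCompactSupport w) :
    Integrable (uncurry fun (x : EuclideanSpace ℝ (Fin 3)) (p : ℝ × (EuclideanSpace ℝ (Fin 3))) =>
        ⟪oseenTensor (ν * (t - p.1)) (x - p.2) (g p.1 p.2), w x⟫)
        ((volume : Measure (EuclideanSpace ℝ (Fin 3))).prod
          ((volume : Measure (ℝ × (EuclideanSpace ℝ (Fin 3)))).restrict (Ioo s t ×ˢ univ))) ∧
      ∫ x, ⟪oseenForceDuhamel ν s g t x, w x⟫ =
        ∫ p in Ioo s t ×ˢ univ,
          (∫ x, ⟪oseenTensor (ν * (t - p.1)) (x - p.2) (g p.1 p.2), w x⟫)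
          ∂(volume : Measure (ℝ × (EuclideanSpace ℝ (Fin 3)))) := by
  set μ : Measure (ℝ × (EuclideanSpace ℝ (Fin 3))) :=
    (volume : Measure (ℝ × (EuclideanSpace ℝ (Fin 3)))).restrict (Ioo s t ×ˢ univ) with hμ
  haveI : SFinite μ := by rw [hμ]; infer_instance
  set F : (EuclideanSpace ℝ (Fin 3)) → ℝ × (EuclideanSpace ℝ (Fin 3)) → (EuclideanSpace ℝ (Fin 3)) :=
    fun x p => oseenTensor (ν * (t - p.1)) (x - p.2) (g p.1 p.2) with hF
  have hKm : AEStronglyMeasurable (fun q : (EuclideanSpace ℝ (Fin 3)) × (ℝ × (EuclideanSpace ℝ (Fin 3))) =>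
      F q.1 q.2) ((volume : Measure (EuclideanSpace ℝ (Fin 3))).prod μ) :=
    aestronglyMeasurable_oseenTensor_pastForce_prod hgc ν ht.le
  have hFm : AEStronglyMeasurable (uncurry fun x p => ⟪F x p, w x⟫)
      ((volume : Measure (EuclideanSpace ℝ (Fin 3))).prod μ) :=
    hKm.inner (hw.aestronglyMeasurable.comp_quasiMeasurePreserving
      (Measure.quasiMeasurePreserving_fst (μ := (volume : Measure (EuclideanSpace ℝ (Fin 3)))) (ν := μ)))
  -- integrability on the product, by Tonelli and the majorant bound
  obtain ⟨κ, hκ, hmaj⟩ := exists_lintegral_enorm_oseenTensor_pastForce_le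
  set B : ENNReal := ENNReal.ofReal (κ * ε * Real.sqrt (t - s) / (Real.sqrt ν * (-t))) with hB
  have hprod : Integrable (uncurry fun x p => ⟪F x p, w x⟫)
      ((volume : Measure (EuclideanSpace ℝ (Fin 3))).prod μ) := by
    refine ⟨hFm, ?_⟩
    rw [hasFiniteIntegral_iff_enorm, lintegral_prod _ hFm.enorm]
    have hwi : ∫⁻ x, ‖w x‖ₑ ∂(volume : Measure (EuclideanSpace ℝ (Fin 3))) < ⊤ :=
      (hw.integrable_of_hasCompactSupport hwc).2
    calc ∫⁻ x, ∫⁻ p, ‖uncurry (fun x p => ⟪F x p, w x⟫) (x, p)‖ₑ ∂μ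
        ≤ ∫⁻ x, ∫⁻ p, ‖F x p‖ₑ * ‖w x‖ₑ ∂μ := by
          refine lintegral_mono fun x => lintegral_mono fun p => ?_
          simp only [uncurry_apply_pair]
          rw [← ofReal_norm, ← ofReal_norm, ← ofReal_norm, ← ENNReal.ofReal_mul (norm_nonneg _)]
          refine ENNReal.ofReal_le_ofReal ?_
          rw [Real.norm_eq_abs]
          exact abs_real_inner_le_norm _ _
      _ = ∫⁻ x, (∫⁻ p, ‖F x p‖ₑ ∂μ) * ‖w x‖ₑ := by
          refine lintegral_congr fun x => ?_
          rw [lintegral_mul_const' _ _ enorm_ne_top]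
      _ ≤ ∫⁻ x, B * ‖w x‖ₑ := by
          refine lintegral_mono fun x => ?_
          gcongr
          rw [hμ, volume_restrict_prod_univ_eq_prod]
          exact (lintegral_prod_le _).trans (hmaj hν g hg hst ht x)
      _ = B * ∫⁻ x, ‖w x‖ₑ := lintegral_const_mul' _ _ ENNReal.ofReal_ne_top
      _ < ⊤ := ENNReal.mul_lt_top ENNReal.ofReal_lt_top hwi
  refine ⟨hprod, ?_⟩
  -- the inner product through the integral, then Fubini
  have hinner : ∀ x, ⟪oseenForceDuhamel ν s g t x, w x⟫ = ∫ p, ⟪F x p, w x⟫ ∂μ := by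
    intro x
    have hint := integrable_oseenTensor_pastForce hν hgc hg hst ht x
    rw [oseenForceDuhamel_eq_integral_prod hν hgc hg hst ht x, real_inner_comm,
      ← integral_inner hint (w x)]
    exact integral_congr_ae (Eventually.of_forall fun p => real_inner_comm _ _)
  calc ∫ x, ⟪oseenForceDuhamel ν s g t x, w x⟫ = ∫ x, ∫ p, ⟪F x p, w x⟫ ∂μ :=
        integral_congr_ae (Eventually.of_forall hinner)
    _ = ∫ p, (∫ x, ⟪F x p, w x⟫) ∂μ := integral_integral_swap hprod

/-- **The adjoint identity for the force term against a test field** `φ ∈ C_c^∞`: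
`∫ ⟪oseenForceDuhamel ν s g t, φ⟫ = ∫_{(s,t)} ∫ ⟪g(τ, y), e^{ν(t−τ)Δ}ℙφ(y)⟫ dy dτ`, the
iterated integral converging absolutely (Lemarié-Rieusset 2016, §6.2: the kernel of
`e^{σΔ}ℙ` is symmetric). [cite: LemarieRieusset2016, §6.2] -/
theorem integral_inner_oseenForceDuhamel_eq_of_contDiff (hν : 0 < ν)
    (hgc : ContinuousOn (uncurry g) (Iio 0 ×ˢ univ))
    (hg : ∀ τ < 0, ∀ y, ‖g τ y‖ ≤ ε / (‖y‖ + Real.sqrt (-τ)) ^ 3) (hst : s < t) (ht : t < 0)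
    {φ : (EuclideanSpace ℝ (Fin 3)) → (EuclideanSpace ℝ (Fin 3))} (hφ : ContDiff ℝ (⊤ : ℕ∞) φ)
    (hφc : HasCompactSupport φ) :
    Integrable (fun p : ℝ × (EuclideanSpace ℝ (Fin 3)) =>
        ⟪g p.1 p.2, UnboundedOperators.heatExtension (classicalLerayProj φ) (ν * (t - p.1)) p.2⟫)
        ((volume : Measure (ℝ × (EuclideanSpace ℝ (Fin 3)))).restrict (Ioo s t ×ˢ univ)) ∧
      ∫ x, ⟪oseenForceDuhamel ν s g t x, φ x⟫ =
        ∫ τ in Ioo s t, ∫ y,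
          ⟪g τ y, UnboundedOperators.heatExtension (classicalLerayProj φ) (ν * (t - τ)) y⟫ := by
  set μ : Measure (ℝ × (EuclideanSpace ℝ (Fin 3))) :=
    (volume : Measure (ℝ × (EuclideanSpace ℝ (Fin 3)))).restrict (Ioo s t ×ˢ univ) with hμ
  set G : ℝ × (EuclideanSpace ℝ (Fin 3)) → ℝ := fun p =>
    ⟪g p.1 p.2, UnboundedOperators.heatExtension (classicalLerayProj φ) (ν * (t - p.1)) p.2⟫ with hG
  obtain ⟨hprod, heq⟩ := integral_inner_oseenForceDuhamel_eq_setIntegral hν hgc hg hst ht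
    hφ.continuous hφc
  -- the tested kernel on `(s,t) × E` is `G`
  have hK : ∀ p ∈ Ioo s t ×ˢ (univ : Set (EuclideanSpace ℝ (Fin 3))),
      ∫ x, ⟪oseenTensor (ν * (t - p.1)) (x - p.2) (g p.1 p.2), φ x⟫ = G p := by
    intro p hp
    rw [mem_prod] at hp
    exact integral_inner_oseenTensor_sub_left_eq_inner_heatExtension_classicalLerayProj hφ hφc
      (mul_pos hν (sub_pos.2 hp.1.2)) p.2 _
  have hGi : Integrable G μ := by
    refine (hprod.integral_prod_right).congr ?_
    filter_upwards [ae_restrict_mem (measurableSet_Ioo.prod MeasurableSet.univ)] with p hp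
    simp only [uncurry]
    exact hK p hp
  refine ⟨hGi, ?_⟩
  rw [heq, setIntegral_congr_fun (measurableSet_Ioo.prod MeasurableSet.univ) hK]
  have hGi' : Integrable G (((volume : Measure ℝ).restrict (Ioo s t)).prod
      (volume : Measure (EuclideanSpace ℝ (Fin 3)))) := by
    rwa [hμ, volume_restrict_prod_univ_eq_prod] at hGi
  rw [volume_restrict_prod_univ_eq_prod, integral_prod _ hGi']

/-- **The force term against a divergence-free test field** (the form entering the duality
identity of classical / very weak solutions): for `φ ∈ C_c^∞` with `div φ = 0`,
`∫ ⟪oseenForceDuhamel ν s g t, φ⟫ = ∫ₛᵗ ∫ ⟪g(τ, y), (heatTest ν φ (t − τ))(y)⟫ dy dτ`.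
[cite: LemarieRieusset2016, §6.2; Thm. 6.1 ((6.12) ⇒ (6.11))] -/
theorem integral_inner_oseenForceDuhamel_of_isDivFree (hν : 0 < ν)
    (hgc : ContinuousOn (uncurry g) (Iio 0 ×ˢ univ))
    (hg : ∀ τ < 0, ∀ y, ‖g τ y‖ ≤ ε / (‖y‖ + Real.sqrt (-τ)) ^ 3) (hst : s < t) (ht : t < 0)
    {φ : (EuclideanSpace ℝ (Fin 3)) → (EuclideanSpace ℝ (Fin 3))} (hφ : ContDiff ℝ (⊤ : ℕ∞) φ)
    (hφc : HasCompactSupport φ) (hdiv : VectorCalculus.IsDivFree φ) :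
    ∫ x, ⟪oseenForceDuhamel ν s g t x, φ x⟫ =
      ∫ τ in s..t, ∫ y, ⟪g τ y, heatTest ν φ (t - τ) y⟫ := by
  rw [(integral_inner_oseenForceDuhamel_eq_of_contDiff hν hgc hg hst ht hφ hφc).2,
    classicalLerayProj_eq_self_of_isDivFree hdiv, intervalIntegral.integral_of_le hst.le,
    integral_Ioc_eq_integral_Ioo]
  refine setIntegral_congr_fun measurableSet_Ioo fun τ hτ => ?_
  have hpos : 0 < t - τ := sub_pos.2 hτ.2
  simp only [heatTest_of_pos hν hpos]

/-- **The force term is weakly divergence free** at every time (test with `φ = ∇θ`: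
`ℙ∇θ = 0`). [cite: LemarieRieusset2016, §6.2] -/
theorem isWeaklyDivFree_oseenForceDuhamel (hν : 0 < ν)
    (hgc : ContinuousOn (uncurry g) (Iio 0 ×ˢ univ))
    (hg : ∀ τ < 0, ∀ y, ‖g τ y‖ ≤ ε / (‖y‖ + Real.sqrt (-τ)) ^ 3) (s : ℝ) (ht : t < 0) :
    IsWeaklyDivFree (oseenForceDuhamel ν s g t) := by
  intro θ hθ
  rcases le_or_gt t s with hts | hst
  · have h0 : ∀ x, oseenForceDuhamel ν s g t x = 0 := fun x => oseenForceDuhamel_of_le hts g ▸ rfl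
    simp [h0]
  have hθs : ContDiff ℝ (⊤ : ℕ∞) θ := hθ.contDiff
  have hgrad : ContDiff ℝ (⊤ : ℕ∞) (gradient θ) := by
    have h1 : ContDiff ℝ (⊤ : ℕ∞) (fderiv ℝ θ) := hθs.fderiv_right (m := (⊤ : ℕ∞)) (by norm_cast)
    exact (InnerProductSpace.toDual ℝ (EuclideanSpace ℝ (Fin 3))).symm.contDiff.comp h1
  have hgs : HasCompactSupport (gradient θ) :=
    (hθ.hasCompactSupport.fderiv (𝕜 := ℝ)).comp_left
      (g := (InnerProductSpace.toDual ℝ (EuclideanSpace ℝ (Fin 3))).symm) (map_zero _)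
  rw [(integral_inner_oseenForceDuhamel_eq_of_contDiff hν hgc hg hst ht hgrad hgs).2,
    classicalLerayProj_gradient hθs hθ.hasCompactSupport]
  have h0 : ∀ σ : ℝ, UnboundedOperators.heatExtension
      (0 : (EuclideanSpace ℝ (Fin 3)) → (EuclideanSpace ℝ (Fin 3))) σ = 0 := fun σ =>
    UnboundedOperators.heatExtension_zero_fun σ
  simp [h0]

end Pairing

/-! ### Decay of the force term along the axis points `n e₁` -/

section Decay

/-- The Hölder majorant `∫ (σ + ‖x − y‖²)^{-3/2} ε(‖y‖ + a)⁻³ dy` tends to zero along `x = n e₁`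
(`L^{3/2} × L³` Hölder on the tail `‖y‖ ≥ R`, smallness of the kernel on the bulk `‖y‖ < R`).
[folklore] -/
private theorem tendsto_integral_majorant_translate_axis {σ a ε : ℝ} (hσ : 0 < σ) (ha : 0 < a)
    (hε : 0 ≤ ε) :
    Tendsto (fun n : ℕ => ∫ y : EuclideanSpace ℝ (Fin 3),
      (σ + ‖(n : ℝ) • (EuclideanSpace.single 0 1 : EuclideanSpace ℝ (Fin 3)) - y‖ ^ 2) ^ (-(3 : ℝ) / 2) *
        (ε / (‖y‖ + a) ^ 3)) atTop (𝓝 0) := by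
  set e₁ : EuclideanSpace ℝ (Fin 3) := EuclideanSpace.single 0 1 with he₁
  have he : ‖e₁‖ = 1 := by
    rw [he₁, PiLp.norm_single (2 : ENNReal) (fun _ : Fin 3 => ℝ) (0 : Fin 3) (1 : ℝ), norm_one]
  have hxs : ∀ n : ℕ, ‖(n : ℝ) • e₁‖ = n := fun n => by
    rw [norm_smul, he, mul_one, Real.norm_natCast]
  -- the two majorants
  have hm0 : ∀ y : EuclideanSpace ℝ (Fin 3), 0 ≤ ε / (‖y‖ + a) ^ 3 := fun y => by positivity
  have hk0 : ∀ (x y : EuclideanSpace ℝ (Fin 3)), 0 ≤ (σ + ‖x - y‖ ^ 2) ^ (-(3 : ℝ) / 2) :=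
    fun x y => by positivity
  have hmc : Continuous fun y : EuclideanSpace ℝ (Fin 3) => ε / (‖y‖ + a) ^ 3 :=
    continuous_const.div (by fun_prop) fun y => by positivity
  obtain ⟨hmp, -⟩ := memLp_forceMajorant ha hε
  -- the Hölder constant `A = ‖k_x‖_{3/2}`, independent of `x`
  set J₁ : ℝ := ∫ w : EuclideanSpace ℝ (Fin 3), ((1 : ℝ) + ‖w‖ ^ 2) ^ (-(9 : ℝ) / 4) with hJ₁
  have hJ₁0 : 0 ≤ J₁ := integral_nonneg fun w => by positivity
  set A : ℝ := (σ ^ (-(3 : ℝ) / 4) * J₁) ^ (1 / (3 / 2 : ℝ)) with hA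
  have hA0 : 0 ≤ A := Real.rpow_nonneg (mul_nonneg (Real.rpow_nonneg hσ.le _) hJ₁0) _
  -- Hölder against the force majorant restricted to a measurable set
  have holder : ∀ (x : EuclideanSpace ℝ (Fin 3)) {S : Set (EuclideanSpace ℝ (Fin 3))},
      MeasurableSet S →
      ∫ y, (σ + ‖x - y‖ ^ 2) ^ (-(3 : ℝ) / 2) * S.indicator (fun y => ε / (‖y‖ + a) ^ 3) y ≤
        A * (∫ y in S, (ε / (‖y‖ + a) ^ 3) ^ (3 : ℝ)) ^ (1 / (3 : ℝ)) := by
    intro x S hS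
    obtain ⟨hkp, hkint⟩ := memLp_kernelMajorant hσ x
    have hind : MemLp (S.indicator fun y : EuclideanSpace ℝ (Fin 3) => ε / (‖y‖ + a) ^ 3)
        (ENNReal.ofReal 3) volume := hmp.indicator hS
    have h := integral_mul_le_Lp_mul_Lq_of_nonneg oseenForce_holderConjugate_threeHalves_three
      (Eventually.of_forall (hk0 x))
      (Eventually.of_forall fun y => Set.indicator_nonneg (fun z _ => hm0 z) y) hkp hind
    rw [hkint] at h
    have hI : ∫ y, (S.indicator (fun y : EuclideanSpace ℝ (Fin 3) => ε / (‖y‖ + a) ^ 3) y) ^ (3 : ℝ) =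
        ∫ y in S, (ε / (‖y‖ + a) ^ 3) ^ (3 : ℝ) := by
      rw [← integral_indicator hS]
      refine integral_congr_ae (Eventually.of_forall fun y => ?_)
      by_cases hy : y ∈ S
      · simp only [Set.indicator_of_mem hy]
      · simp only [Set.indicator_of_notMem hy, Real.zero_rpow (by norm_num : (3 : ℝ) ≠ 0)]
    rw [hI] at h
    exact h
  -- the tail integrals of `m³` tend to zero
  have hint3 : Integrable fun y : EuclideanSpace ℝ (Fin 3) => (ε / (‖y‖ + a) ^ 3) ^ (3 : ℝ) := by
    have h := hmp.integrable_norm_rpow (by simp) (by simp)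
    rw [ENNReal.toReal_ofReal (by norm_num)] at h
    exact h.congr (Eventually.of_forall fun y => by simp only [Real.norm_of_nonneg (hm0 y)])
  have htail : Tendsto (fun R : ℕ => ∫ y in (ball (0 : EuclideanSpace ℝ (Fin 3)) (R : ℝ))ᶜ,
      (ε / (‖y‖ + a) ^ 3) ^ (3 : ℝ)) atTop (𝓝 0) := by
    have hanti : Antitone fun R : ℕ => (ball (0 : EuclideanSpace ℝ (Fin 3)) (R : ℝ))ᶜ :=
      fun i j hij => compl_subset_compl.2 (ball_subset_ball (by exact_mod_cast hij))
    have h := tendsto_setIntegral_of_antitone (μ := (volume : Measure (EuclideanSpace ℝ (Fin 3))))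
      (f := fun y : EuclideanSpace ℝ (Fin 3) => (ε / (‖y‖ + a) ^ 3) ^ (3 : ℝ))
      (fun R => measurableSet_ball.compl) hanti ⟨0, hint3.integrableOn⟩
    have hempty : (⋂ R : ℕ, (ball (0 : EuclideanSpace ℝ (Fin 3)) (R : ℝ))ᶜ) = ∅ := by
      ext y
      simp only [mem_iInter, mem_compl_iff, mem_ball, dist_zero_right, not_lt, mem_empty_iff_false,
        iff_false, not_forall, not_le]
      exact ⟨⌈‖y‖⌉₊ + 1, by push_cast; linarith [Nat.le_ceil ‖y‖]⟩
    rw [hempty, Measure.restrict_empty, integral_zero_measure] at h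
    exact h
  -- `A · tail^{1/3} → 0`
  have htail' : Tendsto (fun R : ℕ => A * (∫ y in (ball (0 : EuclideanSpace ℝ (Fin 3)) (R : ℝ))ᶜ,
      (ε / (‖y‖ + a) ^ 3) ^ (3 : ℝ)) ^ (1 / (3 : ℝ))) atTop (𝓝 0) := by
    have h := (htail.rpow_const (Or.inr (by norm_num : (0 : ℝ) ≤ 1 / 3))).const_mul A
    rwa [Real.zero_rpow (by norm_num), mul_zero] at h
  -- the integrals are nonnegative
  have hI0 : ∀ n : ℕ, 0 ≤ ∫ y : EuclideanSpace ℝ (Fin 3),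
      (σ + ‖(n : ℝ) • e₁ - y‖ ^ 2) ^ (-(3 : ℝ) / 2) * (ε / (‖y‖ + a) ^ 3) :=
    fun n => integral_nonneg fun y => mul_nonneg (hk0 _ y) (hm0 y)
  -- ε/2 argument
  refine Metric.tendsto_atTop.2 fun η hη => ?_
  obtain ⟨R, hR⟩ := (htail'.eventually (Iio_mem_nhds (half_pos hη))).exists
  -- the bulk on `‖y‖ < R`: kernel ≤ (σ + (n − R)²)^{-3/2}` for `n ≥ R`
  set M : ℝ := ∫ y in ball (0 : EuclideanSpace ℝ (Fin 3)) (R : ℝ), ε / (‖y‖ + a) ^ 3 with hM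
  have hM0 : 0 ≤ M := setIntegral_nonneg measurableSet_ball fun y _ => hm0 y
  have hmS : IntegrableOn (fun y : EuclideanSpace ℝ (Fin 3) => ε / (‖y‖ + a) ^ 3)
      (ball (0 : EuclideanSpace ℝ (Fin 3)) (R : ℝ)) :=
    (hmc.continuousOn.integrableOn_compact (isCompact_closedBall (0 : EuclideanSpace ℝ (Fin 3)) R)).mono_set
      ball_subset_closedBall
  have hbulk : ∀ n : ℕ, R ≤ n →
      ∫ y, (σ + ‖(n : ℝ) • e₁ - y‖ ^ 2) ^ (-(3 : ℝ) / 2) *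
        (ball (0 : EuclideanSpace ℝ (Fin 3)) (R : ℝ)).indicator (fun y => ε / (‖y‖ + a) ^ 3) y ≤
      (σ + ((n : ℝ) - R) ^ 2) ^ (-(3 : ℝ) / 2) * M := by
    intro n hn
    have hnR : (0 : ℝ) ≤ (n : ℝ) - R := by
      have : (R : ℝ) ≤ n := by exact_mod_cast hn
      linarith
    have hpt : ∀ y, (σ + ‖(n : ℝ) • e₁ - y‖ ^ 2) ^ (-(3 : ℝ) / 2) *
        (ball (0 : EuclideanSpace ℝ (Fin 3)) (R : ℝ)).indicator (fun y => ε / (‖y‖ + a) ^ 3) y ≤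
        (σ + ((n : ℝ) - R) ^ 2) ^ (-(3 : ℝ) / 2) *
          (ball (0 : EuclideanSpace ℝ (Fin 3)) (R : ℝ)).indicator (fun y => ε / (‖y‖ + a) ^ 3) y := by
      intro y
      by_cases hy : y ∈ ball (0 : EuclideanSpace ℝ (Fin 3)) (R : ℝ)
      · rw [Set.indicator_of_mem hy]
        refine mul_le_mul_of_nonneg_right ?_ (hm0 y)
        have hyR : ‖y‖ < R := by rwa [mem_ball, dist_zero_right] at hy
        have hdist : (n : ℝ) - R ≤ ‖(n : ℝ) • e₁ - y‖ := by
          have h1 := norm_sub_norm_le ((n : ℝ) • e₁) y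
          rw [hxs n] at h1
          linarith
        rw [show (-(3 : ℝ) / 2) = -((3 : ℝ) / 2) by ring]
        exact Real.rpow_le_rpow_of_nonpos (by positivity)
          (by nlinarith [mul_self_le_mul_self hnR hdist]) (by norm_num)
      · simp only [Set.indicator_of_notMem hy, mul_zero, le_refl]
    have hintR : Integrable fun y => (σ + ((n : ℝ) - R) ^ 2) ^ (-(3 : ℝ) / 2) *
        (ball (0 : EuclideanSpace ℝ (Fin 3)) (R : ℝ)).indicator (fun y => ε / (‖y‖ + a) ^ 3) y :=
      (hmS.integrable_indicator measurableSet_ball).const_mul _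
    calc _ ≤ ∫ y, (σ + ((n : ℝ) - R) ^ 2) ^ (-(3 : ℝ) / 2) *
          (ball (0 : EuclideanSpace ℝ (Fin 3)) (R : ℝ)).indicator (fun y => ε / (‖y‖ + a) ^ 3) y :=
          integral_mono_of_nonneg (Eventually.of_forall fun y => mul_nonneg (hk0 _ y)
            (Set.indicator_nonneg (fun z _ => hm0 z) y)) hintR (Eventually.of_forall hpt)
      _ = (σ + ((n : ℝ) - R) ^ 2) ^ (-(3 : ℝ) / 2) * M := by
          rw [integral_const_mul, hM, integral_indicator measurableSet_ball]
  -- the bulk factor tends to zero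
  have hbulk0 : Tendsto (fun n : ℕ => (σ + ((n : ℝ) - R) ^ 2) ^ (-(3 : ℝ) / 2) * M) atTop (𝓝 0) := by
    have h1 : Tendsto (fun n : ℕ => σ + ((n : ℝ) - R) ^ 2) atTop atTop := by
      refine tendsto_atTop_add_const_left _ σ ?_
      have h2 : Tendsto (fun n : ℕ => (n : ℝ) - R) atTop atTop :=
        tendsto_atTop_add_const_right _ (-(R : ℝ)) tendsto_natCast_atTop_atTop |>.congr
          fun n => by ring
      exact (tendsto_pow_atTop two_ne_zero).comp h2
    have h3 : Tendsto (fun n : ℕ => (σ + ((n : ℝ) - R) ^ 2) ^ (-(3 : ℝ) / 2)) atTop (𝓝 0) := by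
      rw [show (-(3 : ℝ) / 2) = -((3 : ℝ) / 2) by ring]
      exact (tendsto_rpow_neg_atTop (by norm_num : (0 : ℝ) < 3 / 2)).comp h1
    simpa using h3.mul_const M
  obtain ⟨N₁, hN₁⟩ := eventually_atTop.1 (hbulk0.eventually (Iio_mem_nhds (half_pos hη)))
  refine ⟨max R N₁, fun n hn => ?_⟩
  have hnR : R ≤ n := le_of_max_le_left hn
  have hnN : N₁ ≤ n := le_of_max_le_right hn
  rw [dist_zero_right, Real.norm_of_nonneg (hI0 n)]
  -- split the force majorant into bulk and tail
  have hsplit : ∫ y, (σ + ‖(n : ℝ) • e₁ - y‖ ^ 2) ^ (-(3 : ℝ) / 2) * (ε / (‖y‖ + a) ^ 3) =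
      (∫ y, (σ + ‖(n : ℝ) • e₁ - y‖ ^ 2) ^ (-(3 : ℝ) / 2) *
        (ball (0 : EuclideanSpace ℝ (Fin 3)) (R : ℝ)).indicator (fun y => ε / (‖y‖ + a) ^ 3) y) +
      ∫ y, (σ + ‖(n : ℝ) • e₁ - y‖ ^ 2) ^ (-(3 : ℝ) / 2) *
        (ball (0 : EuclideanSpace ℝ (Fin 3)) (R : ℝ))ᶜ.indicator (fun y => ε / (‖y‖ + a) ^ 3) y := by
    obtain ⟨hkp, -⟩ := memLp_kernelMajorant hσ ((n : ℝ) • e₁)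
    haveI := oseenForce_holderTriple_threeHalves_three
    have i1 : Integrable fun y => (σ + ‖(n : ℝ) • e₁ - y‖ ^ 2) ^ (-(3 : ℝ) / 2) *
        (ball (0 : EuclideanSpace ℝ (Fin 3)) (R : ℝ)).indicator (fun y => ε / (‖y‖ + a) ^ 3) y :=
      hkp.integrable_mul (hmp.indicator measurableSet_ball)
    have i2 : Integrable fun y => (σ + ‖(n : ℝ) • e₁ - y‖ ^ 2) ^ (-(3 : ℝ) / 2) *
        (ball (0 : EuclideanSpace ℝ (Fin 3)) (R : ℝ))ᶜ.indicator (fun y => ε / (‖y‖ + a) ^ 3) y :=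
      hkp.integrable_mul (hmp.indicator measurableSet_ball.compl)
    rw [← integral_add i1 i2]
    refine integral_congr_ae (Eventually.of_forall fun y => ?_)
    dsimp only
    rw [← mul_add, Set.indicator_self_add_compl_apply]
  rw [hsplit]
  have h1 := hbulk n hnR
  have h2 := holder ((n : ℝ) • e₁) (measurableSet_ball (x := (0 : EuclideanSpace ℝ (Fin 3)))
    (ε := (R : ℝ))).compl
  have h3 : (σ + ((n : ℝ) - R) ^ 2) ^ (-(3 : ℝ) / 2) * M < η / 2 := hN₁ n hnN
  have h4 : A * (∫ y in (ball (0 : EuclideanSpace ℝ (Fin 3)) (R : ℝ))ᶜ,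
      (ε / (‖y‖ + a) ^ 3) ^ (3 : ℝ)) ^ (1 / (3 : ℝ)) < η / 2 := hR
  linarith

/-- **Slices of the force term vanish at infinity along the axis**: for `σ > 0`, `a > 0` and
`‖g₀(y)‖ ≤ ε (‖y‖ + a)⁻³`, `∫ 𝒪_σ(n e₁ − y) g₀(y) dy → 0`. [cite: KochNadirashviliSereginSverak2009, §4 (4.3)–(4.5)] -/
theorem tendsto_integral_oseenTensor_translate_axis {σ a ε : ℝ} (hσ : 0 < σ) (ha : 0 < a)
    {g₀ : (EuclideanSpace ℝ (Fin 3)) → (EuclideanSpace ℝ (Fin 3))}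
    (hg : ∀ y, ‖g₀ y‖ ≤ ε / (‖y‖ + a) ^ 3) :
    Tendsto (fun n : ℕ => ∫ y, oseenTensor σ
      ((n : ℝ) • (EuclideanSpace.single 0 1 : EuclideanSpace ℝ (Fin 3)) - y) (g₀ y)) atTop (𝓝 0) := by
  have hE : 0 < Module.finrank ℝ (EuclideanSpace ℝ (Fin 3)) := by
    rw [finrank_euclideanSpace_fin]; norm_num
  have hd3 : (Module.finrank ℝ (EuclideanSpace ℝ (Fin 3)) : ℝ) = 3 := by
    rw [finrank_euclideanSpace_fin]; norm_num
  obtain ⟨C₀, hC₀, hO⟩ := exists_norm_oseenTensor_le (E := EuclideanSpace ℝ (Fin 3)) hE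
  have hε : 0 ≤ ε := by
    have h1 := (norm_nonneg _).trans (hg 0)
    have h2 : (0 : ℝ) < (‖(0 : EuclideanSpace ℝ (Fin 3))‖ + a) ^ 3 := by simp [ha]
    exact (div_nonneg_iff.1 h1).elim (fun h => h.1) fun h => absurd h.2 (not_le.2 h2)
  set e₁ : EuclideanSpace ℝ (Fin 3) := EuclideanSpace.single 0 1 with he₁
  have hmaj := (tendsto_integral_majorant_translate_axis hσ ha hε).const_mul C₀
  rw [mul_zero] at hmaj
  refine squeeze_zero_norm (fun n => ?_) hmaj
  -- pointwise domination and the norm of the integral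
  obtain ⟨hkp, -⟩ := memLp_kernelMajorant hσ ((n : ℝ) • e₁)
  obtain ⟨hmp, -⟩ := memLp_forceMajorant ha hε
  haveI := oseenForce_holderTriple_threeHalves_three
  have hkm : Integrable fun y => (σ + ‖(n : ℝ) • e₁ - y‖ ^ 2) ^ (-(3 : ℝ) / 2) * (ε / (‖y‖ + a) ^ 3) :=
    hkp.integrable_mul hmp
  have hdom : ∀ y, ‖oseenTensor σ ((n : ℝ) • e₁ - y) (g₀ y)‖ ≤
      C₀ * ((σ + ‖(n : ℝ) • e₁ - y‖ ^ 2) ^ (-(3 : ℝ) / 2) * (ε / (‖y‖ + a) ^ 3)) := by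
    intro y
    have h1 := hO hσ ((n : ℝ) • e₁ - y) (g₀ y)
    rw [hd3] at h1
    calc ‖oseenTensor σ ((n : ℝ) • e₁ - y) (g₀ y)‖
        ≤ C₀ * (σ + ‖(n : ℝ) • e₁ - y‖ ^ 2) ^ (-((3 : ℝ) / 2)) * ‖g₀ y‖ := h1
      _ ≤ C₀ * (σ + ‖(n : ℝ) • e₁ - y‖ ^ 2) ^ (-((3 : ℝ) / 2)) * (ε / (‖y‖ + a) ^ 3) :=
          mul_le_mul_of_nonneg_left (hg y) (by positivity)
      _ = C₀ * ((σ + ‖(n : ℝ) • e₁ - y‖ ^ 2) ^ (-(3 : ℝ) / 2) * (ε / (‖y‖ + a) ^ 3)) := by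
          rw [neg_div]; ring
  calc ‖∫ y, oseenTensor σ ((n : ℝ) • e₁ - y) (g₀ y)‖
      ≤ ∫ y, C₀ * ((σ + ‖(n : ℝ) • e₁ - y‖ ^ 2) ^ (-(3 : ℝ) / 2) * (ε / (‖y‖ + a) ^ 3)) :=
        norm_integral_le_of_norm_le (hkm.const_mul C₀) (Eventually.of_forall hdom)
    _ = C₀ * ∫ y, (σ + ‖(n : ℝ) • e₁ - y‖ ^ 2) ^ (-(3 : ℝ) / 2) * (ε / (‖y‖ + a) ^ 3) :=
        integral_const_mul _ _

variable {ν ε s t : ℝ} {g : ℝ → (EuclideanSpace ℝ (Fin 3)) → (EuclideanSpace ℝ (Fin 3))}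

/-- **The force term vanishes at infinity along the axis**: for `ν > 0`, `s < t < 0` and a force
jointly continuous on the open past with the defect weight,
`oseenForceDuhamel ν s g t (n e₁) → 0` (dominated convergence in `τ` under `K (t − τ)^{-1/2}`,
the slices tending to zero by `tendsto_integral_oseenTensor_translate_axis`); the step "all the
terms in the decomposition again satisfy the decay, so `b` must vanish" of KNSS 2009, proof of
Thm. 6.1. [cite: KochNadirashviliSereginSverak2009, proof of Thm. 6.1, last paragraph (arXiv p. 12)] -/
theorem tendsto_oseenForceDuhamel_translate_axis (hν : 0 < ν)
    (hgc : ContinuousOn (uncurry g) (Iio 0 ×ˢ univ))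
    (hg : ∀ τ < 0, ∀ y, ‖g τ y‖ ≤ ε / (‖y‖ + Real.sqrt (-τ)) ^ 3) (s : ℝ) (ht : t < 0) :
    Tendsto (fun n : ℕ => oseenForceDuhamel ν s g t
      ((n : ℝ) • (EuclideanSpace.single 0 1 : EuclideanSpace ℝ (Fin 3)))) atTop (𝓝 0) := by
  set e₁ : EuclideanSpace ℝ (Fin 3) := EuclideanSpace.single 0 1 with he₁
  obtain ⟨C, hC, hslice⟩ := exists_integral_oseenTensor_weight_le
  have hε : 0 ≤ ε := nonneg_of_pastWeight hg
  have ht0 : 0 < -t := neg_pos.2 ht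
  have hν' : 0 < Real.sqrt ν := Real.sqrt_pos.2 hν
  set K : ℝ := C * ε * (Real.sqrt ν)⁻¹ * (-t)⁻¹ with hK
  -- the time integrands and their majorant
  have hbound : ∀ (x : EuclideanSpace ℝ (Fin 3)), ∀ τ ∈ Ioo s t,
      ‖∫ y, oseenTensor (ν * (t - τ)) (x - y) (g τ y)‖ ≤ K * (t - τ) ^ (-(1 / 2 : ℝ)) := by
    intro x τ hτ
    have hτ0 : τ < 0 := hτ.2.trans ht
    have hτt : 0 < t - τ := sub_pos.2 hτ.2
    have hlag : 0 < ν * (t - τ) := mul_pos hν hτt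
    have ha : 0 < Real.sqrt (-τ) := Real.sqrt_pos.2 (neg_pos.2 hτ0)
    have h1 := (hslice hlag ha hε (g τ) (hg τ hτ0) x).2
    rw [Real.sq_sqrt (neg_pos.2 hτ0).le] at h1
    have hinv : (-τ)⁻¹ ≤ (-t)⁻¹ := inv_anti₀ ht0 (by linarith [hτ.2])
    have hpow : (ν * (t - τ)) ^ (-(1 : ℝ) / 2) = (Real.sqrt ν)⁻¹ * (t - τ) ^ (-(1 / 2 : ℝ)) := by
      rw [Real.mul_rpow hν.le hτt.le, show (-(1 : ℝ) / 2) = -(1 / 2 : ℝ) by norm_num,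
        Real.rpow_neg hν.le, Real.sqrt_eq_rpow]
    calc ‖∫ y, oseenTensor (ν * (t - τ)) (x - y) (g τ y)‖
        ≤ C * ε * (ν * (t - τ)) ^ (-(1 : ℝ) / 2) * (-τ)⁻¹ := h1
      _ = C * ε * (Real.sqrt ν)⁻¹ * (-τ)⁻¹ * (t - τ) ^ (-(1 / 2 : ℝ)) := by rw [hpow]; ring
      _ ≤ C * ε * (Real.sqrt ν)⁻¹ * (-t)⁻¹ * (t - τ) ^ (-(1 / 2 : ℝ)) := by
          have h0 : 0 ≤ (t - τ) ^ (-(1 / 2 : ℝ)) := Real.rpow_nonneg hτt.le _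
          have h3 : 0 ≤ C * ε * (Real.sqrt ν)⁻¹ := by positivity
          nlinarith [mul_le_mul_of_nonneg_left hinv h3]
      _ = K * (t - τ) ^ (-(1 / 2 : ℝ)) := by rw [hK]
  have hint : IntegrableOn (fun τ : ℝ => K * (t - τ) ^ (-(1 / 2 : ℝ))) (Ioo s t) :=
    (integrableOn_sub_rpow_Ioo (by norm_num)).const_mul K
  have h := tendsto_integral_filter_of_dominated_convergence (μ := volume.restrict (Ioo s t))
    (l := atTop) (F := fun (n : ℕ) (τ : ℝ) => ∫ y, oseenTensor (ν * (t - τ)) ((n : ℝ) • e₁ - y) (g τ y))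
    (f := fun _ => (0 : EuclideanSpace ℝ (Fin 3)))
    (fun τ => K * (t - τ) ^ (-(1 / 2 : ℝ))) ?_ ?_ hint ?_
  · simpa [oseenForceDuhamel_apply, integral_zero] using h
  · -- measurability of the slices in `τ`
    refine Eventually.of_forall fun n => ?_
    have h1 := (aestronglyMeasurable_oseenTensor_indicator_pastForce hgc
      ((volume.restrict (Ioo s t)).prod volume) ν t ((n : ℝ) • e₁)).integral_prod_right'
    refine h1.congr ?_
    filter_upwards [ae_restrict_mem measurableSet_Ioo] with τ hτ
    show ∫ y, oseenTensor (ν * (t - τ)) ((n : ℝ) • e₁ - y)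
        ((Iio (0 : ℝ) ×ˢ (univ : Set (EuclideanSpace ℝ (Fin 3)))).indicator (uncurry g) (τ, y)) =
      ∫ y, oseenTensor (ν * (t - τ)) ((n : ℝ) • e₁ - y) (g τ y)
    simp_rw [indicator_pastForce_of_neg (hτ.2.trans ht)]
  · exact Eventually.of_forall fun n =>
      (ae_restrict_iff' measurableSet_Ioo).2 (Eventually.of_forall (hbound ((n : ℝ) • e₁)))
  · refine (ae_restrict_iff' measurableSet_Ioo).2 (Eventually.of_forall fun τ hτ => ?_)
    have hτ0 : τ < 0 := hτ.2.trans ht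
    have hlag : 0 < ν * (t - τ) := mul_pos hν (sub_pos.2 hτ.2)
    have ha : 0 < Real.sqrt (-τ) := Real.sqrt_pos.2 (neg_pos.2 hτ0)
    exact tendsto_integral_oseenTensor_translate_axis hlag ha (hg τ hτ0)

end Decay

end Literature.Analysis.FluidPDE
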